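import Summits.QuantumFields.YangMills.Theorems.BalabanUVNodesN15CurvedGluingSmoothCutDressedGluedGaugedClose
import Summits.QuantumFields.YangMills.Theorems.BalabanUVNodesN15PerCubeGreenJetCubes
import Summits.QuantumFields.YangMills.Theorems.BalabanUVNodesN15PerCubeGreenJetGluingClose
import HarnessLib

/-!
# N15 = NE2, road (c) — PROGRAMME (PC), towards (PC-D) «the per-cube LANDAU LETTER»: WALK LOCALITY OF A LEFT FACTOR THROUGH FILE 47's GLUED OPERATOR — the knit of the dressed
# smooth-cut cubes in per-cube site gauges with a left factor `D` of displayed gauge covariance (n15-c∕269) only feels the data near its two arguments: changing the dressings, the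
# global operator, the far site gauges, the far defects AND THE LEFT FACTOR's species part moves `D∘𝒢` by `[C·(closeness) + C′e^{−(ρ₃∕4−σ)d_Z(y)}]e^{−(ρ₃∕4−2σ)d}` (dag-n15-c g29, n15-c∕301)

Cell `pub-ymgap`, seat `pub-ymgap-dag-n15-c` (generation g29; R134 (a), s1; HUMAN RULING D-0062).  `bears_on: R4∕N15 · K3⁸ SpineGivenEndpointR13SepCoPHV (stmt-QuantumFields-27366)`;
filed `--kind proof --supports stmt-QuantumFields-27366 --as helper` — COUNT-NEUTRAL.  Pure block-majorant algebra; 0 `def`, 0 `sorry`.  GENERATED from the TREE texts of n15-c∕293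
`…CurvedGluingSmoothCutDressedGluedGaugedClose` (two families, close near data) and n15-c∕269 `…PerCubeGreenJetCubes` (left factor) exactly as 269 was generated from FILE 47; closed by
n15-c∕300 `hasMaj_comp_glued_sub_of_localGauges_close`.  Imports those three BY NAME (through them: file 34 `hasMaj_smoothCutDressed_loc₂` ∕ `hasMaj_fgrad∕bgrad_smoothCutDressed_loc₂` ∕
`mulOp_comp_smoothCutDressed` ∕ `jet_smoothCut_out`, file 23 `projO_some_dressedV` ∕ `dressedV_comp_eq_self` ∕ `hasMaj_dressedV_pair` ∕ `hasMaj_V_bgPropVE` ∕ `bgPropV_fix`, FILE 38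
`hasMaj_commOp_cubeOp_smoothCutDressed_in`, file 33 `hasMaj_dressedTail_out`, 269 `hasMaj_comp_exp_out_loc₂`).  Nothing in the tree is modified, nothing restated.

WHY ((PC-D), HOME `PCD-DESIGN-g28.md`).  The per-cube Landau letter needs the CLOSENESS of the gradient entries of [B9] (3.42), `D_VG′(V) − ∂G′(𝟙)` near a cube; one lattice derivative of
the row of `G′(V) − G′(𝟙)` (n15-c∕296) costs the factor `n`, so the left factor is carried through the gluing (n15-c∕300) and only the dressed cubes' own jets are compared.  THIS FILE is
the cube level: on the cubes not `Far` the two families dress the SAME flat smooth-cut cube `M_χ̃N_□` by `V̂_□`, `V̂♭_□ ≤ R_ce^{−δ_Vd}`, so `pr_jX̂ − pr_jX̂♭ = ∇_jM_χ̃N_□(V̂X̂ − V̂♭X̂♭)` is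
`2β̄(R_cβ̄′c_r)c_r`-small WITHOUT differentiating a difference (§1), and the species parts `P_□`, `P♭_□` of the two left factors (both `≤ r_P`, output-localized) contribute `2r_Pβ̄′c_r`.

WHAT.  §1 `hasMaj_jet_dressedV_sub_base_loc₂` (`pr_jX̂ − D_j = D_j(V̂X̂)`, two-sided), `hasMaj_jet_smoothCutDressed_sub_loc₂` (`∇_jM_χX − ∇_jM_χX♭ ≤ 1_S1_S·2β̄(R_cβ̄′c_r)c_r·e^{−ρ₂d}`).
§2 ★★★ `hasMaj_comp_glueInv_sub_smoothCutDressed_localGauges_close`: n15-c∕293's hypotheses (two families `(V̂_□, Δ, u_□, F_□)`, `(V̂♭_□, Δ♭, u♭_□, F♭_□)`, `u♭ = u` and `R_c`-small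
dressings off `Far`, `S_□ ⊆ Z` on `Far`, `8σ ≤ ρ₃`) + n15-c∕269's left-factor hypotheses for BOTH families (`D`, `D♭` with the same Leibniz letters, covariances
`D∘M_{u_kᵀ} = M_{v_kᵀ}∘(∇_j + P_k + P^far_k)`, `D♭∘M_{u♭_kᵀ} = M_{v♭_kᵀ}∘(∇_j + P♭_k + P♭^far_k)`, `v♭ = v` off `Far`) ⟹ `D∘𝒢 − D♭∘𝒢♭ ≤` n15-c∕300's majorant with
`β ↦ β̄′ = β̄(1 − β̄Rc_r²)⁻¹`, `β₁ ↦ β̄′(1 + r_Pc_r)`, `θ₀ ↦ θ + θ_F`, `ε ↦ ε₀(1 − ·)⁻¹ + ε_F`, `ε_G ↦ 2β̄(R_cβ̄′c_r)c_r`, `ε_D ↦ ε_G + 2r_Pβ̄′c_r`, `ε_K ↦ 2θ₀`, `ε_E ↦ 2ε`, rate `ρ₃`.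

HONEST FRAMING ∕ LIMITS.  Algebra of glued inverses and Neumann rows over displayed per-cube rows; no propagator estimated; [B9] (3.34)–(3.35) p.396, (3.42) p.397, (3.62)–(3.65)
pp.402–403, Cor. 3.8 p.410, Thm 3.14 pp.426–427 and [B6] (2.91) p.239, (2.133)–(2.136) p.247 cited for SHAPES ∕ MECHANISM.  NE2⁺ NOT PRINTED, NOT proved; N15 of record untouched;
K3⁸ OPEN; counts UNMOVED; one finite 𝕋⁴ at fixed ε — NOT infinite volume, NOT OS on ℝ⁴, NOT a mass gap, NOT Clay.  Restate-immune (no Theses import).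
-/

set_option autoImplicit false

noncomputable section
open scoped BigOperators Matrix
open Finset

namespace Summit.QuantumFields.YangMills.BalabanUVNodes.N15.CurvedSpecies

open Literature.MathematicalPhysics.QuantumFieldTheory.Balaban1983to89
open Literature.MathematicalPhysics.QuantumFieldTheory.Balaban1983to89.B11SectG (BlockNorm HasMaj RowSum hasMaj_comp_exp)
open Literature.MathematicalPhysics.QuantumFieldTheory.Balaban1983to89.B6RandomWalk (Triangle254)
open Literature.MathematicalPhysics.QuantumFieldTheory.Balaban1983to89.B6Prop26Gluing (mulOp mulOp_apply ind ind_nonneg ind_le_one)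
open Summit.QuantumFields.YangMills.BalabanUVNodes.N15.MatrixSpecies (mmulOp liftBlk liftEquiv liftEquiv_apply liftEquiv_symm_apply)
open Summit.QuantumFields.YangMills.BalabanUVNodes.N15.BackgroundModel (kappa_ofBlocks)
open Summit.QuantumFields.YangMills.BalabanUVNodes.N15.BackgroundLayer (fgrad bgrad fgradAdj stack projO blkPair bgPropV hasMaj_stack bgPropV_fix projO_some_comp_stack)
open Summit.QuantumFields.YangMills.BalabanUVNodes.N15.Gluing (commOp lapOp parametrix remainder glueInv hasMaj_localize)

/-! ## §1 Two dressings of one flat cube: the JETS of the dressed cubes are close -/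

section Rows

variable {X ι J : Type} [Fintype X] [DecidableEq X] [Fintype ι] [DecidableEq ι] [Fintype J] [DecidableEq J] {G₀ : (X × ι → ℝ) →ₗ[ℝ] (X × ι → ℝ)}
  {D Dq : J ⊕ J → (X × ι → ℝ) →ₗ[ℝ] (X × ι → ℝ)} {V V' : ((X × ι) × Option (J ⊕ J) → ℝ) →ₗ[ℝ] (X × ι → ℝ)} {g : B6.Geometry} (blk : X → g.Site) (τ : J → X ≃ X) (n : ℝ) {σ cr : ℝ}
  {N : (X × ι → ℝ) →ₗ[ℝ] (X × ι → ℝ)} {χX χtX ψX : X → ℝ} {S : Set g.Site} {β β₁ ct δ : ℝ}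

/-- ★ **THE DRESSING CORRECTION OF A JET COMPONENT, TWO-SIDED** (file 23's currency): `pr_jX̂ − D_j = D_j∘(V̂X̂)` (`pr_jX̂ = D_j(1 + V̂X̂)`, `pr_jŜ = D_j`), so with `M_χD_j = D_j`,
`G₀ = G₀M_ψ` over `S`, `D_j = Dq_j∘G₀`, `G₀, D_j ≤ βe^{−δd}`, `V̂ ≤ Re^{−δ_Vd}`, file 23's rates and `q = βRc_r² < 1`: `pr_jX̂ − D_j ≤ 1_S(y)1_S(y′)·β(Rβ(1 − q)⁻¹c_r)c_r·e^{−ρ₂d}` —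
n15-c∕293 `hasMaj_dressedV_sub_base_loc₂` for the jet components. [cite: Balaban1985BackgroundPropagators, (3.42) p.397 (gradient entries: shape), (3.63)–(3.65) pp.402–403 (mechanism); King1986, Prop. 3.9 (3.73) p.665 (separate derivative kernels: shape)] -/
theorem hasMaj_jet_dressedV_sub_base_loc₂ (htri : Triangle254 g) (hd : ∀ a b : g.Site, 0 ≤ g.dist a b) (hrow : RowSum g σ cr) (hσ : 0 ≤ σ) {ρ₁ ρ₂ δ δV β R : ℝ} (hβ : 0 ≤ β)
    (hR : 0 ≤ R) (hcr : 0 ≤ cr) (hσρ : σ ≤ ρ₁) (hρ₁V : ρ₁ ≤ δV) (hρ₁G : ρ₁ + σ ≤ δ) (hρ₂ : 0 ≤ ρ₂) (hρ₂₁ : ρ₂ + σ ≤ ρ₁) {S : Set g.Site} {χX ψX : X → ℝ}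
    (hSχ : ∀ x, χX x ≠ 0 → blk x ∈ S) (hSψ : ∀ x, ψX x ≠ 0 → blk x ∈ S) (j : J ⊕ J) (hDχ : mulOp (fun p : X × ι => χX p.1) ∘ₗ D j = D j)
    (hGψ : G₀ ∘ₗ mulOp (fun p : X × ι => ψX p.1) = G₀) (hDq : ∀ j, D j = Dq j ∘ₗ G₀)
    (hG : HasMaj (BlockNorm.ofBlocks g (liftBlk blk ι)) (BlockNorm.ofBlocks g (liftBlk blk ι)) G₀ (fun y y' => β * Real.exp (-(δ * g.dist y y'))))
    (hD : ∀ j, HasMaj (BlockNorm.ofBlocks g (liftBlk blk ι)) (BlockNorm.ofBlocks g (liftBlk blk ι)) (D j) (fun y y' => β * Real.exp (-(δ * g.dist y y'))))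
    (hV : HasMaj (BlockNorm.ofBlocks g (blkPair (liftBlk blk ι))) (BlockNorm.ofBlocks g (liftBlk blk ι)) V (fun y y' => R * Real.exp (-(δV * g.dist y y'))))
    (hq : β * (R * cr) * cr < 1) :
    HasMaj (BlockNorm.ofBlocks g (liftBlk blk ι)) (BlockNorm.ofBlocks g (liftBlk blk ι)) (projO (some j) ∘ₗ bgPropV (stack G₀ D) V - D j)
      (fun y y' => ind S y * ind S y' * (β * (R * (β * (1 - β * (R * cr) * cr)⁻¹) * cr) * cr * Real.exp (-(ρ₂ * g.dist y y')))) := by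
  obtain ⟨hunit, -⟩ := hasMaj_dressedV_pair blk htri hd hrow hσ hβ hR hcr hσρ hρ₁V hρ₁G hρ₂ hρ₂₁ hG hD hV hq
  have hSt := hasMaj_stack (liftBlk blk ι) (fun _ _ => mul_nonneg hβ (Real.exp_nonneg _)) hG hD
  have hVX := hasMaj_V_bgPropVE (liftBlk blk ι) (blkPair (liftBlk blk ι)) htri hd hrow hσ hβ hR hcr hσρ hρ₁V hρ₁G hρ₂ hρ₂₁ hSt hV hq
  have hc : 0 ≤ R * (β * (1 - β * (R * cr) * cr)⁻¹) * cr := mul_nonneg (mul_nonneg hR (mul_nonneg hβ (inv_nonneg.2 (by linarith)))) hcr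
  have hρ₂G : ρ₂ + σ ≤ δ := by linarith
  have hfix := bgPropV_fix hunit
  have hfac : projO (some j) ∘ₗ bgPropV (stack G₀ D) V = (projO (some j) ∘ₗ stack G₀ D) ∘ₗ (LinearMap.id + V ∘ₗ bgPropV (stack G₀ D) V) := by
    conv_lhs => rw [hfix]
    rw [LinearMap.comp_add, LinearMap.comp_add, LinearMap.comp_id, LinearMap.comp_assoc, LinearMap.comp_assoc]
  have heq : projO (some j) ∘ₗ bgPropV (stack G₀ D) V - D j = D j ∘ₗ (V ∘ₗ bgPropV (stack G₀ D) V) := by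
    rw [hfac, projO_some_comp_stack, LinearMap.comp_add, LinearMap.comp_id, add_sub_cancel_left]
  have hinp := dressedV_comp_eq_self (V := V) hDq hGψ
  rw [heq]
  refine hasMaj_localize (liftBlk blk ι) (liftBlk blk ι) (fun a b => mul_nonneg (mul_nonneg (mul_nonneg hβ hc) hcr) (Real.exp_nonneg _)) (fun μ p hp => ?_) (fun μ hμ => ?_)
    ((hasMaj_comp_exp htri hd hrow hβ hc hρ₂ le_rfl hρ₂G (hD j) hVX).mono fun a b => le_of_eq (by rw [kappa_ofBlocks]; ring))
  · have hχ0 : χX p.1 = 0 := by by_contra h; exact hp (hSχ p.1 h)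
    have h1 : (D j ∘ₗ (V ∘ₗ bgPropV (stack G₀ D) V)) μ = mulOp (fun p : X × ι => χX p.1) (D j ((V ∘ₗ bgPropV (stack G₀ D) V) μ)) := by
      rw [LinearMap.comp_apply, ← LinearMap.comp_apply (mulOp _) (D j), hDχ]
    rw [h1, mulOp_apply, hχ0, zero_mul]
  · rw [LinearMap.comp_apply, LinearMap.comp_apply, ← hinp, LinearMap.comp_apply, mulOp_eq_zero_of_vanish blk hSψ μ hμ, map_zero, map_zero, map_zero]

/-- ★★ **THE JETS OF TWO DRESSINGS OF THE SAME SMOOTH-CUT CUBE ARE CLOSE** (file 34's currency): under n15-c∕293 `hasMaj_smoothCutDressed_sub_loc₂`'s hypotheses plus the jet pieces'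
reversed insertions, for every jet index `j = ±μ`: `∇_j∘M_χX − ∇_j∘M_χX♭ ≤ 1_S(y)1_S(y′)·2β̄(R_cβ̄(1 − β̄Rc_r²)⁻¹c_r)c_r·e^{−ρ₂d}` — both `pr_jX̂ − ∇_jM_χ̃N_□` and `pr_jX̂♭ − ∇_jM_χ̃N_□`
are the previous lemma's corrections, `M_χX = X`, `pr_jX̂ = ∇_j∘X` (file 23 `projO_some_dressedV`). [cite: Balaban1985BackgroundPropagators, (3.42) p.397 (gradient entries: shape), (3.63)–(3.65) pp.402–403, Cor. 3.8 p.410 (mechanism); Balaban1984PropagatorsII, (2.133) p.247 (shape)] -/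
theorem hasMaj_jet_smoothCutDressed_sub_loc₂ (htri : Triangle254 g) (hd : ∀ a b : g.Site, 0 ≤ g.dist a b) (hrow : RowSum g σ cr) (hσ : 0 ≤ σ) {ρ₁ ρ₂ δV R Rc : ℝ} (hβ : 0 ≤ β)
    (hβ₁ : 0 ≤ β₁) (hct : 0 ≤ ct) (hRc : 0 ≤ Rc) (hRcR : Rc ≤ R) (hcr : 0 ≤ cr) (hσρ : σ ≤ ρ₁) (hρ₁V : ρ₁ ≤ δV) (hρ₁G : ρ₁ + σ ≤ δ) (hρ₂ : 0 ≤ ρ₂) (hρ₂₁ : ρ₂ + σ ≤ ρ₁)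
    (hSχ : ∀ x, χX x ≠ 0 → blk x ∈ S) (hSψ : ∀ x, ψX x ≠ 0 → blk x ∈ S) (hχt : ∀ x, |χtX x| ≤ 1)
    (hdχt : ∀ μ p, |fgrad n (liftEquiv (τ μ) ι) (fun p : X × ι => χtX p.1) p| ≤ ct) (hdχtb : ∀ μ p, |bgrad n (liftEquiv (τ μ) ι) (fun p : X × ι => χtX p.1) p| ≤ ct)
    (hsub : mulOp (fun p : X × ι => χtX p.1) ∘ₗ mulOp (fun p : X × ι => χX p.1) = mulOp (fun p : X × ι => χtX p.1))
    (hχ : mulOp (fun p : X × ι => χX p.1) ∘ₗ mulOp (fun p : X × ι => χtX p.1) = mulOp (fun p : X × ι => χtX p.1))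
    (hs : ∀ μ, mulOp ((fun p : X × ι => χtX p.1) ∘ (liftEquiv (τ μ) ι)) ∘ₗ mulOp (fun p : X × ι => χX p.1) = mulOp ((fun p : X × ι => χtX p.1) ∘ (liftEquiv (τ μ) ι)))
    (hsb : ∀ μ, mulOp ((fun p : X × ι => χtX p.1) ∘ (liftEquiv (τ μ) ι).symm) ∘ₗ mulOp (fun p : X × ι => χX p.1) = mulOp ((fun p : X × ι => χtX p.1) ∘ (liftEquiv (τ μ) ι).symm))
    (hdd : ∀ μ, mulOp (fgrad n (liftEquiv (τ μ) ι) (fun p : X × ι => χtX p.1)) ∘ₗ mulOp (fun p : X × ι => χX p.1) = mulOp (fgrad n (liftEquiv (τ μ) ι) (fun p : X × ι => χtX p.1)))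
    (hddb : ∀ μ, mulOp (bgrad n (liftEquiv (τ μ) ι) (fun p : X × ι => χtX p.1)) ∘ₗ mulOp (fun p : X × ι => χX p.1) = mulOp (bgrad n (liftEquiv (τ μ) ι) (fun p : X × ι => χtX p.1)))
    (hs' : ∀ μ, mulOp (fun p : X × ι => χX p.1) ∘ₗ mulOp ((fun p : X × ι => χtX p.1) ∘ (liftEquiv (τ μ) ι)) = mulOp ((fun p : X × ι => χtX p.1) ∘ (liftEquiv (τ μ) ι)))
    (hsb' : ∀ μ, mulOp (fun p : X × ι => χX p.1) ∘ₗ mulOp ((fun p : X × ι => χtX p.1) ∘ (liftEquiv (τ μ) ι).symm) = mulOp ((fun p : X × ι => χtX p.1) ∘ (liftEquiv (τ μ) ι).symm))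
    (hdd' : ∀ μ, mulOp (fun p : X × ι => χX p.1) ∘ₗ mulOp (fgrad n (liftEquiv (τ μ) ι) (fun p : X × ι => χtX p.1)) = mulOp (fgrad n (liftEquiv (τ μ) ι) (fun p : X × ι => χtX p.1)))
    (hddb' : ∀ μ, mulOp (fun p : X × ι => χX p.1) ∘ₗ mulOp (bgrad n (liftEquiv (τ μ) ι) (fun p : X × ι => χtX p.1)) = mulOp (bgrad n (liftEquiv (τ μ) ι) (fun p : X × ι => χtX p.1)))
    (hNψ : N ∘ₗ mulOp (fun p : X × ι => ψX p.1) = N)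
    (hcut : HasMaj (BlockNorm.ofBlocks g (liftBlk blk ι)) (BlockNorm.ofBlocks g (liftBlk blk ι)) (mulOp (fun p : X × ι => χX p.1) ∘ₗ N)
      (fun y y' => ind S y * ind S y' * (β * Real.exp (-(δ * g.dist y y')))))
    (hcutF : ∀ μ, HasMaj (BlockNorm.ofBlocks g (liftBlk blk ι)) (BlockNorm.ofBlocks g (liftBlk blk ι)) (mulOp (fun p : X × ι => χX p.1) ∘ₗ (fgrad n (liftEquiv (τ μ) ι) ∘ₗ N))
      (fun y y' => ind S y * ind S y' * (β₁ * Real.exp (-(δ * g.dist y y')))))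
    (hcutB : ∀ μ, HasMaj (BlockNorm.ofBlocks g (liftBlk blk ι)) (BlockNorm.ofBlocks g (liftBlk blk ι)) (mulOp (fun p : X × ι => χX p.1) ∘ₗ (bgrad n (liftEquiv (τ μ) ι) ∘ₗ N))
      (fun y y' => ind S y * ind S y' * (β₁ * Real.exp (-(δ * g.dist y y')))))
    (hV : HasMaj (BlockNorm.ofBlocks g (blkPair (liftBlk blk ι))) (BlockNorm.ofBlocks g (liftBlk blk ι)) V (fun y y' => Rc * Real.exp (-(δV * g.dist y y'))))
    (hV' : HasMaj (BlockNorm.ofBlocks g (blkPair (liftBlk blk ι))) (BlockNorm.ofBlocks g (liftBlk blk ι)) V' (fun y y' => Rc * Real.exp (-(δV * g.dist y y'))))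
    (hq : (β + (β₁ + ct * β)) * (R * cr) * cr < 1) (jj : J ⊕ J) :
    HasMaj (BlockNorm.ofBlocks g (liftBlk blk ι)) (BlockNorm.ofBlocks g (liftBlk blk ι))
      (Sum.elim (fun μ => fgrad n (liftEquiv (τ μ) ι)) (fun μ => bgrad n (liftEquiv (τ μ) ι)) jj ∘ₗ (mulOp (fun p : X × ι => χX p.1) ∘ₗ (projO none ∘ₗ bgPropV (stack (mulOp (fun p : X × ι => χtX p.1) ∘ₗ N) (fun j => Sum.elim (fun μ => fgrad n (liftEquiv (τ μ) ι)) (fun μ => bgrad n (liftEquiv (τ μ) ι)) j ∘ₗ (mulOp (fun p : X × ι => χtX p.1) ∘ₗ N))) V)) -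
        Sum.elim (fun μ => fgrad n (liftEquiv (τ μ) ι)) (fun μ => bgrad n (liftEquiv (τ μ) ι)) jj ∘ₗ (mulOp (fun p : X × ι => χX p.1) ∘ₗ (projO none ∘ₗ bgPropV (stack (mulOp (fun p : X × ι => χtX p.1) ∘ₗ N) (fun j => Sum.elim (fun μ => fgrad n (liftEquiv (τ μ) ι)) (fun μ => bgrad n (liftEquiv (τ μ) ι)) j ∘ₗ (mulOp (fun p : X × ι => χtX p.1) ∘ₗ N))) V')))
      (fun y y' => ind S y * ind S y' * (2 * ((β + (β₁ + ct * β)) * (Rc * ((β + (β₁ + ct * β)) * (1 - (β + (β₁ + ct * β)) * (R * cr) * cr)⁻¹) * cr) * cr) * Real.exp (-(ρ₂ * g.dist y y')))) := by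
  have hβb : 0 ≤ β + (β₁ + ct * β) := by positivity
  have hle : (β + (β₁ + ct * β)) * (Rc * cr) * cr ≤ (β + (β₁ + ct * β)) * (R * cr) * cr :=
    mul_le_mul_of_nonneg_right (mul_le_mul_of_nonneg_left (mul_le_mul_of_nonneg_right hRcR hcr) hβb) hcr
  have hqc : (β + (β₁ + ct * β)) * (Rc * cr) * cr < 1 := hle.trans_lt hq
  have hinv : (1 - (β + (β₁ + ct * β)) * (Rc * cr) * cr)⁻¹ ≤ (1 - (β + (β₁ + ct * β)) * (R * cr) * cr)⁻¹ := inv_anti₀ (by linarith) (by linarith)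
  have hc : (β + (β₁ + ct * β)) * (Rc * ((β + (β₁ + ct * β)) * (1 - (β + (β₁ + ct * β)) * (Rc * cr) * cr)⁻¹) * cr) * cr ≤
      (β + (β₁ + ct * β)) * (Rc * ((β + (β₁ + ct * β)) * (1 - (β + (β₁ + ct * β)) * (R * cr) * cr)⁻¹) * cr) * cr :=
    mul_le_mul_of_nonneg_right (mul_le_mul_of_nonneg_left (mul_le_mul_of_nonneg_right (mul_le_mul_of_nonneg_left (mul_le_mul_of_nonneg_left hinv hβb) hRc) hcr) hβb) hcr
  have hG := hasMaj_smoothCut_flat blk (S := S) hβ hβ₁ hct hχt hsub hcut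
  have hD := hasMaj_jet_smoothCut_flat blk τ n (S := S) hβ hβ₁ hct hχt hdχt hdχtb hs hsb hdd hddb hcut hcutF hcutB
  have hunit := (hasMaj_dressedV_pair blk htri hd hrow hσ hβb hRc hcr hσρ hρ₁V hρ₁G hρ₂ hρ₂₁ hG hD hV hqc).1
  have hunit' := (hasMaj_dressedV_pair blk htri hd hrow hσ hβb hRc hcr hσρ hρ₁V hρ₁G hρ₂ hρ₂₁ hG hD hV' hqc).1
  have hout := jet_smoothCut_out τ n (N := N) hs hsb hdd hddb hs' hsb' hdd' hddb' jj
  have h1 := hasMaj_jet_dressedV_sub_base_loc₂ blk htri hd hrow hσ hβb hRc hcr hσρ hρ₁V hρ₁G hρ₂ hρ₂₁ hSχ hSψ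
    (D := fun j => Sum.elim (fun μ => fgrad n (liftEquiv (τ μ) ι)) (fun μ => bgrad n (liftEquiv (τ μ) ι)) j ∘ₗ (mulOp (fun p : X × ι => χtX p.1) ∘ₗ N)) jj hout (smoothCut_in hNψ)
    (fun _ => rfl) hG hD hV hqc
  have h2 := hasMaj_jet_dressedV_sub_base_loc₂ blk htri hd hrow hσ hβb hRc hcr hσρ hρ₁V hρ₁G hρ₂ hρ₂₁ hSχ hSψ
    (D := fun j => Sum.elim (fun μ => fgrad n (liftEquiv (τ μ) ι)) (fun μ => bgrad n (liftEquiv (τ μ) ι)) j ∘ₗ (mulOp (fun p : X × ι => χtX p.1) ∘ₗ N)) jj hout (smoothCut_in hNψ)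
    (fun _ => rfl) hG hD hV' hqc
  rw [projO_some_dressedV (fun _ => rfl) hunit jj] at h1
  rw [projO_some_dressedV (fun _ => rfl) hunit' jj] at h2
  rw [mulOp_comp_smoothCutDressed τ n hχ hNψ hunit, mulOp_comp_smoothCutDressed τ n hχ hNψ hunit',
    ← sub_sub_sub_cancel_right _ _ (Sum.elim (fun μ => fgrad n (liftEquiv (τ μ) ι)) (fun μ => bgrad n (liftEquiv (τ μ) ι)) jj ∘ₗ (mulOp (fun p : X × ι => χtX p.1) ∘ₗ N))]
  refine (h1.sub h2).mono fun y y' => ?_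
  have hw : 0 ≤ ind S y * ind S y' := mul_nonneg (ind_nonneg _ _) (ind_nonneg _ _)
  calc ind S y * ind S y' * ((β + (β₁ + ct * β)) * (Rc * ((β + (β₁ + ct * β)) * (1 - (β + (β₁ + ct * β)) * (Rc * cr) * cr)⁻¹) * cr) * cr * Real.exp (-(ρ₂ * g.dist y y'))) +
        ind S y * ind S y' * ((β + (β₁ + ct * β)) * (Rc * ((β + (β₁ + ct * β)) * (1 - (β + (β₁ + ct * β)) * (Rc * cr) * cr)⁻¹) * cr) * cr * Real.exp (-(ρ₂ * g.dist y y')))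
      = ind S y * ind S y' * (2 * ((β + (β₁ + ct * β)) * (Rc * ((β + (β₁ + ct * β)) * (1 - (β + (β₁ + ct * β)) * (Rc * cr) * cr)⁻¹) * cr) * cr) * Real.exp (-(ρ₂ * g.dist y y'))) := by ring
    _ ≤ ind S y * ind S y' * (2 * ((β + (β₁ + ct * β)) * (Rc * ((β + (β₁ + ct * β)) * (1 - (β + (β₁ + ct * β)) * (R * cr) * cr)⁻¹) * cr) * cr) * Real.exp (-(ρ₂ * g.dist y y'))) :=
      mul_le_mul_of_nonneg_left (mul_le_mul_of_nonneg_right (mul_le_mul_of_nonneg_left hc zero_le_two) (Real.exp_nonneg _)) hw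

end Rows

/-! ## §2 FILE 47's glued operator with a left factor: walk locality under a change of dressings, global operator, far gauges, far defects and the left factor -/

section Glue

variable {X ι J K : Type} [Fintype X] [DecidableEq X] [Fintype ι] [DecidableEq ι] [Fintype J] [DecidableEq J] [Fintype K] {g : B6.Geometry} (blk : X → g.Site) (τ : J → X ≃ X) (n : ℝ)
  {σ cr : ℝ} {N : K → (X × ι → ℝ) →ₗ[ℝ] (X × ι → ℝ)} {V : K → ((X × ι) × Option (J ⊕ J) → ℝ) →ₗ[ℝ] (X × ι → ℝ)} {Δ W NL : (X × ι → ℝ) →ₗ[ℝ] (X × ι → ℝ)}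
  {F : K → (X × ι → ℝ) →ₗ[ℝ] (X × ι → ℝ)} {ug : K → X → Matrix ι ι ℝ} {χX χtX ψX hX : K → X → ℝ} {Sk : K → Set g.Site} {hb : K → g.Site → ℝ} {β β₁ ct δ θF εF : ℝ}
variable {V₂ : K → ((X × ι) × Option (J ⊕ J) → ℝ) →ₗ[ℝ] (X × ι → ℝ)} {Δ₂ : (X × ι → ℝ) →ₗ[ℝ] (X × ι → ℝ)} {F₂ : K → (X × ι → ℝ) →ₗ[ℝ] (X × ι → ℝ)} {ug₂ : K → X → Matrix ι ι ℝ}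
  (Far : K → Prop) [DecidablePred Far] (Z : Set g.Site) (dZ : g.Site → ℝ)

set_option maxHeartbeats 800000 in
/-- ★★★ **WALK LOCALITY OF A LEFT FACTOR THROUGH FILE 47's GLUED OPERATOR UNDER A CHANGE OF THE DRESSINGS, THE GLOBAL OPERATOR, THE FAR SITE GAUGES, THE FAR DEFECTS AND THE LEFT
FACTOR** — n15-c∕293's hypotheses (ONE set of flat smooth-cut cubes `N_□`, cuts, partition, tails, `W`-letters and commutator letters; TWO families `(V̂_□, Δ, u_□, F_□)`, `(V̂♭_□, Δ♭, u♭_□, F♭_□)`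
with the same letters; `u♭_□ = u_□` and both dressings `R_c`-small on the cubes not `Far`, `S_□ ⊆ Z` on the far cubes, `8σ ≤ ρ₃`) and n15-c∕269's left-factor hypotheses for both families
(`D`, `D♭` with the same Leibniz letters `c_s, c_d`; covariances `D∘M_{u_kᵀ} = M_{v_kᵀ}∘(∇_j + P_k + P^far_k)`, `D♭∘M_{u♭_kᵀ} = M_{v♭_kᵀ}∘(∇_j + P♭_k + P♭^far_k)` with `P_k, P♭_k ≤ 1_{S_k}(y)·r_Pe^{−ρ_Pd}`,
`P^far_k∘M_{χ_k} = P♭^far_k∘M_{χ_k} = 0`, `v♭_k = v_k` off `Far`) ⟹ `D∘𝒢 − D♭∘𝒢♭ ≤ [C_near + C_far·e^{−(ρ₃∕4−σ)d_Z(y)}]·e^{−(ρ₃∕4−2σ)d}` — n15-c∕300 fed with FILE 47's ∕ 269's per-cube rows for both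
families and §1's jet closeness. [cite: Balaban1985BackgroundPropagators, (3.34)–(3.35) p.396, (3.42) p.397 (gradient entries: shape), Cor. 3.8 p.410, (3.62)–(3.65) pp.402–403, Thm 3.14 pp.426–427 (mechanism); Balaban1984PropagatorsII, (2.91) p.239, (2.133)–(2.136) p.247] -/
theorem hasMaj_comp_glueInv_sub_smoothCutDressed_localGauges_close (htri : Triangle254 g) (hd : ∀ a b : g.Site, 0 ≤ g.dist a b) (hd0 : ∀ y : g.Site, g.dist y y = 0) (hsymm : ∀ y y', g.dist y y' = g.dist y' y) (hdZ : ∀ y z, z ∈ Z → dZ y ≤ g.dist y z) (hdZ0 : ∀ y, 0 ≤ dZ y)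
    (hrow : RowSum g σ cr) (hσ : 0 ≤ σ) {ρ₁ ρ₂ ρ₃ ρN ρT δV ε R ε₀ c₁ c₂ θW cN ℓ ω d₁ Nov : ℝ} (hβ : 0 ≤ β) (hβ₁ : 0 ≤ β₁) (hct : 0 ≤ ct) (hR : 0 ≤ R) (hε₀ : 0 ≤ ε₀) (hcr : 0 ≤ cr) (hNov : 0 ≤ Nov) (hσρ : σ ≤ ρ₁) (hρ₁V : ρ₁ ≤ δV)
    (hρ₁G : ρ₁ + σ ≤ δ) (hρ₂ : 0 ≤ ρ₂) (hρ₂₁ : ρ₂ + σ ≤ ρ₁) (hρ₂T : ρ₂ + σ ≤ ρT) (hρ₃ : 0 ≤ ρ₃) (hρ₃₂ : ρ₃ ≤ ρ₂) (hρ₃V : ρ₃ + σ ≤ δV - ε) (hρ₃N : ρ₃ + σ ≤ ρN) (hσρ₃ : 8 * σ ≤ ρ₃)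
    (hε : 0 < ε) (hc₁ : 0 ≤ c₁) (hc₂ : 0 ≤ c₂) (hθW : 0 ≤ θW) (hcN : 0 ≤ cN) (hℓ : 0 ≤ ℓ) (hω : 0 ≤ ω) (hd₁ : 0 ≤ d₁)
    -- per cube: supports, the bump and its insertions (both ways), the input cut-off
    (hSχ : ∀ k x, χX k x ≠ 0 → blk x ∈ Sk k) (hSψ : ∀ k x, ψX k x ≠ 0 → blk x ∈ Sk k) (hχt : ∀ k x, |χtX k x| ≤ 1)
    (hdχt : ∀ k μ p, |fgrad n (liftEquiv (τ μ) ι) (fun p : X × ι => χtX k p.1) p| ≤ ct) (hdχtb : ∀ k μ p, |bgrad n (liftEquiv (τ μ) ι) (fun p : X × ι => χtX k p.1) p| ≤ ct)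
    (hsub : ∀ k, mulOp (fun p : X × ι => χtX k p.1) ∘ₗ mulOp (fun p : X × ι => χX k p.1) = mulOp (fun p : X × ι => χtX k p.1))
    (hχ : ∀ k, mulOp (fun p : X × ι => χX k p.1) ∘ₗ mulOp (fun p : X × ι => χtX k p.1) = mulOp (fun p : X × ι => χtX k p.1))
    (hs : ∀ k μ, mulOp ((fun p : X × ι => χtX k p.1) ∘ (liftEquiv (τ μ) ι)) ∘ₗ mulOp (fun p : X × ι => χX k p.1) = mulOp ((fun p : X × ι => χtX k p.1) ∘ (liftEquiv (τ μ) ι)))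
    (hsb : ∀ k μ, mulOp ((fun p : X × ι => χtX k p.1) ∘ (liftEquiv (τ μ) ι).symm) ∘ₗ mulOp (fun p : X × ι => χX k p.1) = mulOp ((fun p : X × ι => χtX k p.1) ∘ (liftEquiv (τ μ) ι).symm))
    (hdd : ∀ k μ, mulOp (fgrad n (liftEquiv (τ μ) ι) (fun p : X × ι => χtX k p.1)) ∘ₗ mulOp (fun p : X × ι => χX k p.1) = mulOp (fgrad n (liftEquiv (τ μ) ι) (fun p : X × ι => χtX k p.1)))
    (hddb : ∀ k μ, mulOp (bgrad n (liftEquiv (τ μ) ι) (fun p : X × ι => χtX k p.1)) ∘ₗ mulOp (fun p : X × ι => χX k p.1) = mulOp (bgrad n (liftEquiv (τ μ) ι) (fun p : X × ι => χtX k p.1)))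
    (hs' : ∀ k μ, mulOp (fun p : X × ι => χX k p.1) ∘ₗ mulOp ((fun p : X × ι => χtX k p.1) ∘ (liftEquiv (τ μ) ι)) = mulOp ((fun p : X × ι => χtX k p.1) ∘ (liftEquiv (τ μ) ι)))
    (hsb' : ∀ k μ, mulOp (fun p : X × ι => χX k p.1) ∘ₗ mulOp ((fun p : X × ι => χtX k p.1) ∘ (liftEquiv (τ μ) ι).symm) = mulOp ((fun p : X × ι => χtX k p.1) ∘ (liftEquiv (τ μ) ι).symm))
    (hdd' : ∀ k μ, mulOp (fun p : X × ι => χX k p.1) ∘ₗ mulOp (fgrad n (liftEquiv (τ μ) ι) (fun p : X × ι => χtX k p.1)) = mulOp (fgrad n (liftEquiv (τ μ) ι) (fun p : X × ι => χtX k p.1)))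
    (hddb' : ∀ k μ, mulOp (fun p : X × ι => χX k p.1) ∘ₗ mulOp (bgrad n (liftEquiv (τ μ) ι) (fun p : X × ι => χtX k p.1)) = mulOp (bgrad n (liftEquiv (τ μ) ι) (fun p : X × ι => χtX k p.1)))
    (hNψ : ∀ k, N k ∘ₗ mulOp (fun p : X × ι => ψX k p.1) = N k)
    -- per cube: FILE 63's cut rows
    (hcut : ∀ k, HasMaj (BlockNorm.ofBlocks g (liftBlk blk ι)) (BlockNorm.ofBlocks g (liftBlk blk ι)) (mulOp (fun p : X × ι => χX k p.1) ∘ₗ N k) (fun y y' => ind (Sk k) y * ind (Sk k) y' * (β * Real.exp (-(δ * g.dist y y')))))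
    (hcutF : ∀ k μ, HasMaj (BlockNorm.ofBlocks g (liftBlk blk ι)) (BlockNorm.ofBlocks g (liftBlk blk ι)) (mulOp (fun p : X × ι => χX k p.1) ∘ₗ (fgrad n (liftEquiv (τ μ) ι) ∘ₗ N k)) (fun y y' => ind (Sk k) y * ind (Sk k) y' * (β₁ * Real.exp (-(δ * g.dist y y')))))
    (hcutB : ∀ k μ, HasMaj (BlockNorm.ofBlocks g (liftBlk blk ι)) (BlockNorm.ofBlocks g (liftBlk blk ι)) (mulOp (fun p : X × ι => χX k p.1) ∘ₗ (bgrad n (liftEquiv (τ μ) ι) ∘ₗ N k)) (fun y y' => ind (Sk k) y * ind (Sk k) y' * (β₁ * Real.exp (-(δ * g.dist y y')))))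
    -- per cube: the partition (`|h| ≤ 1`, `Σh² = 1`, supported in the cut: `M_hM_χ = M_h`, letters `c₁, c₂`, block reading `hb` with `ℓ, ω`), one-step block distance `d₁`, overlap `N_ov`
    (hhabs : ∀ k x, |hX k x| ≤ 1) (hhcut : ∀ k, mulOp (fun p : X × ι => hX k p.1) ∘ₗ mulOp (fun p : X × ι => χX k p.1) = mulOp (fun p : X × ι => hX k p.1))
    (hh1 : ∀ k μ p, |fgrad n (liftEquiv (τ μ) ι) (fun p : X × ι => hX k p.1) p| ≤ c₁) (hh1b : ∀ k μ p, |bgrad n (liftEquiv (τ μ) ι) (fun p : X × ι => hX k p.1) p| ≤ c₁) (hh2 : ∀ k μ p, |fgradAdj n (liftEquiv (τ μ) ι) (fgrad n (liftEquiv (τ μ) ι) (fun p : X × ι => hX k p.1)) p| ≤ c₂)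
    (hLip : ∀ k y y', |hb k y - hb k y'| ≤ ℓ * g.dist y y') (hrh : ∀ k (p : X × ι), |hX k p.1 - hb k (liftBlk blk ι p)| ≤ ω) (hstep : ∀ μ x, g.dist (blk (τ μ x)) (blk x) ≤ d₁)
    (hN : ∀ a, ∑ k, ind (Sk k) a ≤ Nov)
    -- per cube: the tail row (dag-n15-a's images geometry ∕ FILE 68's far sandwich)
    (hT : ∀ k, HasMaj (BlockNorm.ofBlocks g (liftBlk blk ι)) (BlockNorm.ofBlocks g (liftBlk blk ι)) ((-(mulOp (fun p : X × ι => hX k p.1) ∘ₗ NL ∘ₗ mulOp (1 - fun p : X × ι => χtX k p.1))) ∘ₗ N k) (fun y y' => ind (Sk k) y * ind (Sk k) y' * (ε₀ * Real.exp (-(ρT * g.dist y y')))))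
    -- per cube, IN THE CUBE's GAUGE: the cube's perturbation `V̂_k` of the jet (small on the cube's region), smallness, the `W`-rows, the flat nonlocal summand's commutator letters
    (hV : ∀ k, HasMaj (BlockNorm.ofBlocks g (blkPair (liftBlk blk ι))) (BlockNorm.ofBlocks g (liftBlk blk ι)) (V k) (fun y y' => R * Real.exp (-(δV * g.dist y y'))))
    (hq : (β + (β₁ + ct * β)) * (R * cr) * cr < 1)
    (hW : ∀ k, HasMaj (BlockNorm.ofBlocks g (liftBlk blk ι)) (BlockNorm.ofBlocks g (liftBlk blk ι)) (commOp W (fun p : X × ι => hX k p.1) ∘ₗ (projO none ∘ₗ bgPropV (stack (mulOp (fun p : X × ι => χtX k p.1) ∘ₗ N k)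
          (fun j => Sum.elim (fun μ => fgrad n (liftEquiv (τ μ) ι)) (fun μ => bgrad n (liftEquiv (τ μ) ι)) j ∘ₗ (mulOp (fun p : X × ι => χtX k p.1) ∘ₗ N k))) (V k)))
      (fun y y' => ind (Sk k) y * ind (Sk k) y' * (θW * Real.exp (-(ρ₂ * g.dist y y')))))
    (hKN : ∀ k, HasMaj (BlockNorm.ofBlocks g (liftBlk blk ι)) (BlockNorm.ofBlocks g (liftBlk blk ι)) (commOp NL (fun p : X × ι => hX k p.1)) (fun y y' => cN * Real.exp (-(ρN * g.dist y y'))))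
    -- per cube: the ORTHOGONAL SITE GAUGE `u_k` of (3.35), the GLOBAL operator `Δ` read in it = the cube's model operator up to a far defect `F_k`, and `F_k`'s two rows against the cube
    (hug : ∀ k x, ug k x * (ug k x)ᵀ = 1) (hug' : ∀ k x, (ug k x)ᵀ * ug k x = 1) (hθF : 0 ≤ θF) (hεF : 0 ≤ εF)
    (hcov : ∀ k, mmulOp (ug k) ∘ₗ Δ ∘ₗ mmulOp (fun x => (ug k x)ᵀ) = (lapOp n (fun μ => liftEquiv (τ μ) ι) W + NL - V k ∘ₗ stack LinearMap.id (fun j => Sum.elim (fun μ => fgrad n (liftEquiv (τ μ) ι)) (fun μ => bgrad n (liftEquiv (τ μ) ι)) j)) + F k)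
    (hFK : ∀ k, HasMaj (BlockNorm.ofBlocks g (liftBlk blk ι)) (BlockNorm.ofBlocks g (liftBlk blk ι)) (commOp (F k) (fun p : X × ι => hX k p.1) ∘ₗ (projO none ∘ₗ bgPropV (stack (mulOp (fun p : X × ι => χtX k p.1) ∘ₗ N k) (fun j => Sum.elim (fun μ => fgrad n (liftEquiv (τ μ) ι)) (fun μ => bgrad n (liftEquiv (τ μ) ι)) j ∘ₗ (mulOp (fun p : X × ι => χtX k p.1) ∘ₗ N k))) (V k)))
      (fun y y' => ind (Sk k) y' * (θF * Real.exp (-(ρ₃ * g.dist y y')))))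
    (hFX : ∀ k, HasMaj (BlockNorm.ofBlocks g (liftBlk blk ι)) (BlockNorm.ofBlocks g (liftBlk blk ι)) (mulOp (fun p : X × ι => hX k p.1) ∘ₗ F k ∘ₗ (projO none ∘ₗ bgPropV (stack (mulOp (fun p : X × ι => χtX k p.1) ∘ₗ N k) (fun j => Sum.elim (fun μ => fgrad n (liftEquiv (τ μ) ι)) (fun μ => bgrad n (liftEquiv (τ μ) ι)) j ∘ₗ (mulOp (fun p : X × ι => χtX k p.1) ∘ₗ N k))) (V k)))
      (fun y y' => ind (Sk k) y * (εF * Real.exp (-(ρ₃ * g.dist y y')))))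
    (hq' : Nov * ((Fintype.card ι : ℝ) ^ 2 * ((((Fintype.card J : ℝ) * (c₂ * ((β + (β₁ + ct * β)) * (1 - (β + (β₁ + ct * β)) * (R * cr) * cr)⁻¹) + 2 * (c₁ * ((β + (β₁ + ct * β)) * (1 - (β + (β₁ + ct * β)) * (R * cr) * cr)⁻¹))) + θW + cN * ((β + (β₁ + ct * β)) * (1 - (β + (β₁ + ct * β)) * (R * cr) * cr)⁻¹) * cr)
          + ((ℓ * (Real.exp 1 * ε)⁻¹ + 2 * (ω + ℓ * d₁)) * R * ((β + (β₁ + ct * β)) * (1 - (β + (β₁ + ct * β)) * (R * cr) * cr)⁻¹) * cr + R * c₁ * ((β + (β₁ + ct * β)) * (1 - (β + (β₁ + ct * β)) * (R * cr) * cr)⁻¹) * cr)) + θF) + (Fintype.card ι : ℝ) ^ 2 * ((ε₀ * (1 - (β + (β₁ + ct * β)) * (R * cr) * cr)⁻¹) + εF)) * cr < 1)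
    -- THE SECOND FAMILY: the same flat cubes, cuts, partition and tails, dressed by `V̂♭_k`, the global `Δ♭` read in the site gauges `u♭_k` with far defects `F♭_k` (same letters)
    (hV₂ : ∀ k, HasMaj (BlockNorm.ofBlocks g (blkPair (liftBlk blk ι))) (BlockNorm.ofBlocks g (liftBlk blk ι)) (V₂ k) (fun y y' => R * Real.exp (-(δV * g.dist y y'))))
    (hW₂ : ∀ k, HasMaj (BlockNorm.ofBlocks g (liftBlk blk ι)) (BlockNorm.ofBlocks g (liftBlk blk ι)) (commOp W (fun p : X × ι => hX k p.1) ∘ₗ (projO none ∘ₗ bgPropV (stack (mulOp (fun p : X × ι => χtX k p.1) ∘ₗ N k)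
          (fun j => Sum.elim (fun μ => fgrad n (liftEquiv (τ μ) ι)) (fun μ => bgrad n (liftEquiv (τ μ) ι)) j ∘ₗ (mulOp (fun p : X × ι => χtX k p.1) ∘ₗ N k))) (V₂ k)))
      (fun y y' => ind (Sk k) y * ind (Sk k) y' * (θW * Real.exp (-(ρ₂ * g.dist y y')))))
    (hug₂ : ∀ k x, ug₂ k x * (ug₂ k x)ᵀ = 1) (hug₂' : ∀ k x, (ug₂ k x)ᵀ * ug₂ k x = 1)
    (hcov₂ : ∀ k, mmulOp (ug₂ k) ∘ₗ Δ₂ ∘ₗ mmulOp (fun x => (ug₂ k x)ᵀ) = (lapOp n (fun μ => liftEquiv (τ μ) ι) W + NL - V₂ k ∘ₗ stack LinearMap.id (fun j => Sum.elim (fun μ => fgrad n (liftEquiv (τ μ) ι)) (fun μ => bgrad n (liftEquiv (τ μ) ι)) j)) + F₂ k)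
    (hFK₂ : ∀ k, HasMaj (BlockNorm.ofBlocks g (liftBlk blk ι)) (BlockNorm.ofBlocks g (liftBlk blk ι)) (commOp (F₂ k) (fun p : X × ι => hX k p.1) ∘ₗ (projO none ∘ₗ bgPropV (stack (mulOp (fun p : X × ι => χtX k p.1) ∘ₗ N k) (fun j => Sum.elim (fun μ => fgrad n (liftEquiv (τ μ) ι)) (fun μ => bgrad n (liftEquiv (τ μ) ι)) j ∘ₗ (mulOp (fun p : X × ι => χtX k p.1) ∘ₗ N k))) (V₂ k)))
      (fun y y' => ind (Sk k) y' * (θF * Real.exp (-(ρ₃ * g.dist y y')))))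
    (hFX₂ : ∀ k, HasMaj (BlockNorm.ofBlocks g (liftBlk blk ι)) (BlockNorm.ofBlocks g (liftBlk blk ι)) (mulOp (fun p : X × ι => hX k p.1) ∘ₗ F₂ k ∘ₗ (projO none ∘ₗ bgPropV (stack (mulOp (fun p : X × ι => χtX k p.1) ∘ₗ N k) (fun j => Sum.elim (fun μ => fgrad n (liftEquiv (τ μ) ι)) (fun μ => bgrad n (liftEquiv (τ μ) ι)) j ∘ₗ (mulOp (fun p : X × ι => χtX k p.1) ∘ₗ N k))) (V₂ k)))
      (fun y y' => ind (Sk k) y * (εF * Real.exp (-(ρ₃ * g.dist y y')))))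
    -- FAR ∕ NEAR: on the cubes not `Far` the site gauges agree; the far cubes' regions lie in `Z`
    (hZ : ∀ k, Far k → Sk k ⊆ Z) (hWW : ∀ k, ¬Far k → ug₂ k = ug k)
    -- THE CLOSENESS RADIUS: on the cubes not `Far` both dressings are `R_c`-small, `R_c ≤ R` (the Neumann radius)
    {Rc : ℝ} (hRc : 0 ≤ Rc) (hRcR : Rc ≤ R) (hVc : ∀ k, ¬Far k → HasMaj (BlockNorm.ofBlocks g (blkPair (liftBlk blk ι))) (BlockNorm.ofBlocks g (liftBlk blk ι)) (V k) (fun y y' => Rc * Real.exp (-(δV * g.dist y y'))))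
    (hVc₂ : ∀ k, ¬Far k → HasMaj (BlockNorm.ofBlocks g (blkPair (liftBlk blk ι))) (BlockNorm.ofBlocks g (liftBlk blk ι)) (V₂ k) (fun y y' => Rc * Real.exp (-(δV * g.dist y y'))))
    -- THE LEFT FACTOR: a jet index, the global operator `D`, its Leibniz rule through the partition, its GAUGE COVARIANCE `D∘M_{u_kᵀ} = M_{v_kᵀ}∘(∇_j + P_k + P^far_k)` with a second
    -- orthogonal family `v_k`, the species part `P_k` (output-localized on the cube's region, small) and the far part `P^far_k` (annihilated by the cube's cut-off)
    (jj : J ⊕ J) {Dg : (X × ι → ℝ) →ₗ[ℝ] (X × ι → ℝ)} {vg : K → X → Matrix ι ι ℝ} {P Pf : K → (X × ι → ℝ) →ₗ[ℝ] (X × ι → ℝ)} {hsX dhX : K → X → ℝ} {cs cd rP ρP : ℝ}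
    (hcs : 0 ≤ cs) (hcd : 0 ≤ cd) (hrP : 0 ≤ rP) (hρP : ρ₃ + σ ≤ ρP) (hvg' : ∀ k x, (vg k x)ᵀ * vg k x = 1)
    (hDcov : ∀ k, Dg ∘ₗ mmulOp (fun x => (ug k x)ᵀ) = mmulOp (fun x => (vg k x)ᵀ) ∘ₗ (Sum.elim (fun μ => fgrad n (liftEquiv (τ μ) ι)) (fun μ => bgrad n (liftEquiv (τ μ) ι)) jj + P k + Pf k))
    (hDleib : ∀ k, Dg ∘ₗ mulOp (fun p : X × ι => hX k p.1) = mulOp (fun p : X × ι => hsX k p.1) ∘ₗ Dg + mulOp (fun p : X × ι => dhX k p.1))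
    (hhs : ∀ k (p : X × ι), |hsX k p.1| ≤ cs) (hdh : ∀ k (p : X × ι), |dhX k p.1| ≤ cd)
    (hP : ∀ k, HasMaj (BlockNorm.ofBlocks g (liftBlk blk ι)) (BlockNorm.ofBlocks g (liftBlk blk ι)) (P k) (fun y y' => ind (Sk k) y * (rP * Real.exp (-(ρP * g.dist y y')))))
    (hPf : ∀ k, Pf k ∘ₗ mulOp (fun p : X × ι => χX k p.1) = 0)
    -- THE SECOND LEFT FACTOR `D♭` (same Leibniz letters): its covariance in the second family's gauges with the orthogonal family `v♭_k`, species part `P♭_k`, far part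
    -- `P♭^far_k`; on the cubes not `Far` the covariance families agree
    {Dg₂ : (X × ι → ℝ) →ₗ[ℝ] (X × ι → ℝ)} {vg₂ : K → X → Matrix ι ι ℝ} {P₂ Pf₂ : K → (X × ι → ℝ) →ₗ[ℝ] (X × ι → ℝ)} (hvg₂' : ∀ k x, (vg₂ k x)ᵀ * vg₂ k x = 1)
    (hDcov₂ : ∀ k, Dg₂ ∘ₗ mmulOp (fun x => (ug₂ k x)ᵀ) = mmulOp (fun x => (vg₂ k x)ᵀ) ∘ₗ (Sum.elim (fun μ => fgrad n (liftEquiv (τ μ) ι)) (fun μ => bgrad n (liftEquiv (τ μ) ι)) jj + P₂ k + Pf₂ k))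
    (hDleib₂ : ∀ k, Dg₂ ∘ₗ mulOp (fun p : X × ι => hX k p.1) = mulOp (fun p : X × ι => hsX k p.1) ∘ₗ Dg₂ + mulOp (fun p : X × ι => dhX k p.1))
    (hP₂ : ∀ k, HasMaj (BlockNorm.ofBlocks g (liftBlk blk ι)) (BlockNorm.ofBlocks g (liftBlk blk ι)) (P₂ k) (fun y y' => ind (Sk k) y * (rP * Real.exp (-(ρP * g.dist y y')))))
    (hPf₂ : ∀ k, Pf₂ k ∘ₗ mulOp (fun p : X × ι => χX k p.1) = 0) (hvv : ∀ k, ¬Far k → vg₂ k = vg k) :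
    HasMaj (BlockNorm.ofBlocks g (liftBlk blk ι)) (BlockNorm.ofBlocks g (liftBlk blk ι))
      (Dg ∘ₗ glueInv (parametrix (fun k (p : X × ι) => hX k p.1) (fun k => mmulOp (fun x => (ug k x)ᵀ) ∘ₗ (projO none ∘ₗ bgPropV (stack (mulOp (fun p : X × ι => χtX k p.1) ∘ₗ N k) (fun j => Sum.elim (fun μ => fgrad n (liftEquiv (τ μ) ι)) (fun μ => bgrad n (liftEquiv (τ μ) ι)) j ∘ₗ (mulOp (fun p : X × ι => χtX k p.1) ∘ₗ N k))) (V k)) ∘ₗ mmulOp (ug k))) (remainder Δ (fun k (p : X × ι) => hX k p.1) (fun k => mmulOp (fun x => (ug k x)ᵀ) ∘ₗ (projO none ∘ₗ bgPropV (stack (mulOp (fun p : X × ι => χtX k p.1) ∘ₗ N k) (fun j => Sum.elim (fun μ => fgrad n (liftEquiv (τ μ) ι)) (fun μ => bgrad n (liftEquiv (τ μ) ι)) j ∘ₗ (mulOp (fun p : X × ι => χtX k p.1) ∘ₗ N k))) (V k)) ∘ₗ mmulOp (ug k)) - ∑ k, (mmulOp (fun x => (ug k x)ᵀ) ∘ₗ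 ((((-(mulOp (fun p : X × ι => hX k p.1) ∘ₗ NL ∘ₗ mulOp (1 - fun p : X × ι => χtX k p.1))) ∘ₗ N k) ∘ₗ (LinearMap.id + (V k ∘ₗ stack LinearMap.id (fun j => Sum.elim (fun μ => fgrad n (liftEquiv (τ μ) ι)) (fun μ => bgrad n (liftEquiv (τ μ) ι)) j)) ∘ₗ (projO none ∘ₗ bgPropV (stack (mulOp (fun p : X × ι => χtX k p.1) ∘ₗ N k) (fun j => Sum.elim (fun μ => fgrad n (liftEquiv (τ μ) ι)) (fun μ => bgrad n (liftEquiv (τ μ) ι)) j ∘ₗ (mulOp (fun p : X × ι => χtX k p.1) ∘ₗ N k))) (V k))) + mulOp (fun p : X × ι => hX k p.1) ∘ₗ F k ∘ₗ (projO none ∘ₗ bgPropV (stack (mulOp (fun p : X × ι => χtX k p.1) ∘ₗ N k) (fun j => Sum.elim (fun μ => fgrad n (liftEquiv (τ μ) ι)) (fun μ => bgrad n (liftEquiv (τ μ) ι)) j ∘ₗ (mulOp (fun p : X × ι => χtX k p.1) ∘ₗ N k))) (V k)))) ∘ₗ mmulOp (ug k)) ∘ₗ mulOp (fun p : X × ι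 => hX k p.1)) -
        Dg₂ ∘ₗ glueInv (parametrix (fun k (p : X × ι) => hX k p.1) (fun k => mmulOp (fun x => (ug₂ k x)ᵀ) ∘ₗ (projO none ∘ₗ bgPropV (stack (mulOp (fun p : X × ι => χtX k p.1) ∘ₗ N k) (fun j => Sum.elim (fun μ => fgrad n (liftEquiv (τ μ) ι)) (fun μ => bgrad n (liftEquiv (τ μ) ι)) j ∘ₗ (mulOp (fun p : X × ι => χtX k p.1) ∘ₗ N k))) (V₂ k)) ∘ₗ mmulOp (ug₂ k))) (remainder Δ₂ (fun k (p : X × ι) => hX k p.1) (fun k => mmulOp (fun x => (ug₂ k x)ᵀ) ∘ₗ (projO none ∘ₗ bgPropV (stack (mulOp (fun p : X × ι => χtX k p.1) ∘ₗ N k) (fun j => Sum.elim (fun μ => fgrad n (liftEquiv (τ μ) ι)) (fun μ => bgrad n (liftEquiv (τ μ) ι)) j ∘ₗ (mulOp (fun p : X × ι => χtX k p.1) ∘ₗ N k))) (V₂ k)) ∘ₗ mmulOp (ug₂ k)) - ∑ k, (mmulOp (fun x => (ug₂ k x)ᵀ) ∘ₗ ((((-(mulOp (fun p : X × ι => hX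 k p.1) ∘ₗ NL ∘ₗ mulOp (1 - fun p : X × ι => χtX k p.1))) ∘ₗ N k) ∘ₗ (LinearMap.id + (V₂ k ∘ₗ stack LinearMap.id (fun j => Sum.elim (fun μ => fgrad n (liftEquiv (τ μ) ι)) (fun μ => bgrad n (liftEquiv (τ μ) ι)) j)) ∘ₗ (projO none ∘ₗ bgPropV (stack (mulOp (fun p : X × ι => χtX k p.1) ∘ₗ N k) (fun j => Sum.elim (fun μ => fgrad n (liftEquiv (τ μ) ι)) (fun μ => bgrad n (liftEquiv (τ μ) ι)) j ∘ₗ (mulOp (fun p : X × ι => χtX k p.1) ∘ₗ N k))) (V₂ k))) + mulOp (fun p : X × ι => hX k p.1) ∘ₗ F₂ k ∘ₗ (projO none ∘ₗ bgPropV (stack (mulOp (fun p : X × ι => χtX k p.1) ∘ₗ N k) (fun j => Sum.elim (fun μ => fgrad n (liftEquiv (τ μ) ι)) (fun μ => bgrad n (liftEquiv (τ μ) ι)) j ∘ₗ (mulOp (fun p : X × ι => χtX k p.1) ∘ₗ N k))) (V₂ k)))) ∘ₗ mmulOp (ug₂ k)) ∘ₗ mulOp (fun p : X × ι => hX k p.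1)))
      (fun y y' => ((Nov * (cs * ((Fintype.card ι : ℝ) ^ 2 * ((2 * ((β + (β₁ + ct * β)) * (Rc * ((β + (β₁ + ct * β)) * (1 - (β + (β₁ + ct * β)) * (R * cr) * cr)⁻¹) * cr) * cr)) + 2 * (rP * ((β + (β₁ + ct * β)) * (1 - (β + (β₁ + ct * β)) * (R * cr) * cr)⁻¹) * cr))) + cd * ((Fintype.card ι : ℝ) ^ 2 * (2 * ((β + (β₁ + ct * β)) * (Rc * ((β + (β₁ + ct * β)) * (1 - (β + (β₁ + ct * β)) * (R * cr) * cr)⁻¹) * cr) * cr)))) +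
            Nov * (cs * ((Fintype.card ι : ℝ) ^ 2 * (((β + (β₁ + ct * β)) * (1 - (β + (β₁ + ct * β)) * (R * cr) * cr)⁻¹) + rP * ((β + (β₁ + ct * β)) * (1 - (β + (β₁ + ct * β)) * (R * cr) * cr)⁻¹) * cr)) + cd * ((Fintype.card ι : ℝ) ^ 2 * ((β + (β₁ + ct * β)) * (1 - (β + (β₁ + ct * β)) * (R * cr) * cr)⁻¹))) * ((1 - Nov * ((Fintype.card ι : ℝ) ^ 2 * ((((Fintype.card J : ℝ) * (c₂ * ((β + (β₁ + ct * β)) * (1 - (β + (β₁ + ct * β)) * (R * cr) * cr)⁻¹) + 2 * (c₁ * ((β + (β₁ + ct * β)) * (1 - (β + (β₁ + ct * β)) * (R * cr) * cr)⁻¹))) + θW + cN * ((β + (β₁ + ct * β)) * (1 - (β + (β₁ + ct * β)) * (R * cr) * cr)⁻¹) * cr) + ((ℓ * (Real.exp 1 * ε)⁻¹ + 2 * (ω + ℓ * d₁)) * R * ((β + (β₁ + ct * β)) * (1 - (β + (β₁ + ct * β)) * (R * cr) * cr)⁻¹) * cr + R * c₁ * ((β + (β₁ + ct * β)) * (1 -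 (β + (β₁ + ct * β)) * (R * cr) * cr)⁻¹) * cr)) + θF) + (Fintype.card ι : ℝ) ^ 2 * ((ε₀ * (1 - (β + (β₁ + ct * β)) * (R * cr) * cr)⁻¹) + εF)) * cr)⁻¹ * cr) *
              (Nov * ((Fintype.card ι : ℝ) ^ 2 * (2 * ((((Fintype.card J : ℝ) * (c₂ * ((β + (β₁ + ct * β)) * (1 - (β + (β₁ + ct * β)) * (R * cr) * cr)⁻¹) + 2 * (c₁ * ((β + (β₁ + ct * β)) * (1 - (β + (β₁ + ct * β)) * (R * cr) * cr)⁻¹))) + θW + cN * ((β + (β₁ + ct * β)) * (1 - (β + (β₁ + ct * β)) * (R * cr) * cr)⁻¹) * cr) + ((ℓ * (Real.exp 1 * ε)⁻¹ + 2 * (ω + ℓ * d₁)) * R * ((β + (β₁ + ct * β)) * (1 - (β + (β₁ + ct * β)) * (R * cr) * cr)⁻¹) * cr + R * c₁ * ((β + (β₁ + ct * β)) * (1 - (β + (β₁ + ct * β)) * (R * cr) * cr)⁻¹) * cr)) + θF)) + (Fintype.card ι : ℝ) ^ 2 * (2 * ((ε₀ * (1 - (β + (β₁ + ct * β)) * (R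 * cr) * cr)⁻¹) + εF)))) * cr) * ((1 - Nov * ((Fintype.card ι : ℝ) ^ 2 * ((((Fintype.card J : ℝ) * (c₂ * ((β + (β₁ + ct * β)) * (1 - (β + (β₁ + ct * β)) * (R * cr) * cr)⁻¹) + 2 * (c₁ * ((β + (β₁ + ct * β)) * (1 - (β + (β₁ + ct * β)) * (R * cr) * cr)⁻¹))) + θW + cN * ((β + (β₁ + ct * β)) * (1 - (β + (β₁ + ct * β)) * (R * cr) * cr)⁻¹) * cr) + ((ℓ * (Real.exp 1 * ε)⁻¹ + 2 * (ω + ℓ * d₁)) * R * ((β + (β₁ + ct * β)) * (1 - (β + (β₁ + ct * β)) * (R * cr) * cr)⁻¹) * cr + R * c₁ * ((β + (β₁ + ct * β)) * (1 - (β + (β₁ + ct * β)) * (R * cr) * cr)⁻¹) * cr)) + θF) + (Fintype.card ι : ℝ) ^ 2 * ((ε₀ * (1 - (β + (β₁ + ct * β)) * (R * cr) * cr)⁻¹) + εF)) * cr)⁻¹ * cr) +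
          (Nov * (cs * (2 * ((Fintype.card ι : ℝ) ^ 2 * (((β + (β₁ + ct * β)) * (1 - (β + (β₁ + ct * β)) * (R * cr) * cr)⁻¹) + rP * ((β + (β₁ + ct * β)) * (1 - (β + (β₁ + ct * β)) * (R * cr) * cr)⁻¹) * cr))) + cd * (2 * ((Fintype.card ι : ℝ) ^ 2 * ((β + (β₁ + ct * β)) * (1 - (β + (β₁ + ct * β)) * (R * cr) * cr)⁻¹)))) +
            Nov * (cs * ((Fintype.card ι : ℝ) ^ 2 * (((β + (β₁ + ct * β)) * (1 - (β + (β₁ + ct * β)) * (R * cr) * cr)⁻¹) + rP * ((β + (β₁ + ct * β)) * (1 - (β + (β₁ + ct * β)) * (R * cr) * cr)⁻¹) * cr)) + cd * ((Fintype.card ι : ℝ) ^ 2 * ((β + (β₁ + ct * β)) * (1 - (β + (β₁ + ct * β)) * (R * cr) * cr)⁻¹))) * ((1 - Nov * ((Fintype.card ι : ℝ) ^ 2 * ((((Fintype.card J : ℝ) * (c₂ * ((β + (β₁ + ct * β)) * (1 - (β + (β₁ + ct * β)) * (R * cr) * cr)⁻¹) + 2 * (c₁ * ((β + (β₁ + ct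 * β)) * (1 - (β + (β₁ + ct * β)) * (R * cr) * cr)⁻¹))) + θW + cN * ((β + (β₁ + ct * β)) * (1 - (β + (β₁ + ct * β)) * (R * cr) * cr)⁻¹) * cr) + ((ℓ * (Real.exp 1 * ε)⁻¹ + 2 * (ω + ℓ * d₁)) * R * ((β + (β₁ + ct * β)) * (1 - (β + (β₁ + ct * β)) * (R * cr) * cr)⁻¹) * cr + R * c₁ * ((β + (β₁ + ct * β)) * (1 - (β + (β₁ + ct * β)) * (R * cr) * cr)⁻¹) * cr)) + θF) + (Fintype.card ι : ℝ) ^ 2 * ((ε₀ * (1 - (β + (β₁ + ct * β)) * (R * cr) * cr)⁻¹) + εF)) * cr)⁻¹ * cr) *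
              (Nov * (2 * ((Fintype.card ι : ℝ) ^ 2 * ((ε₀ * (1 - (β + (β₁ + ct * β)) * (R * cr) * cr)⁻¹) + εF))) + Nov * (2 * ((Fintype.card ι : ℝ) ^ 2 * ((((Fintype.card J : ℝ) * (c₂ * ((β + (β₁ + ct * β)) * (1 - (β + (β₁ + ct * β)) * (R * cr) * cr)⁻¹) + 2 * (c₁ * ((β + (β₁ + ct * β)) * (1 - (β + (β₁ + ct * β)) * (R * cr) * cr)⁻¹))) + θW + cN * ((β + (β₁ + ct * β)) * (1 - (β + (β₁ + ct * β)) * (R * cr) * cr)⁻¹) * cr) + ((ℓ * (Real.exp 1 * ε)⁻¹ + 2 * (ω + ℓ * d₁)) * R * ((β + (β₁ + ct * β)) * (1 - (β + (β₁ + ct * β)) * (R * cr) * cr)⁻¹) * cr + R * c₁ * ((β + (β₁ + ct * β)) * (1 - (β + (β₁ + ct * β)) * (R * cr) * cr)⁻¹) * cr)) + θF)))) * cr) *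
            ((1 - Nov * ((Fintype.card ι : ℝ) ^ 2 * ((((Fintype.card J : ℝ) * (c₂ * ((β + (β₁ + ct * β)) * (1 - (β + (β₁ + ct * β)) * (R * cr) * cr)⁻¹) + 2 * (c₁ * ((β + (β₁ + ct * β)) * (1 - (β + (β₁ + ct * β)) * (R * cr) * cr)⁻¹))) + θW + cN * ((β + (β₁ + ct * β)) * (1 - (β + (β₁ + ct * β)) * (R * cr) * cr)⁻¹) * cr) + ((ℓ * (Real.exp 1 * ε)⁻¹ + 2 * (ω + ℓ * d₁)) * R * ((β + (β₁ + ct * β)) * (1 - (β + (β₁ + ct * β)) * (R * cr) * cr)⁻¹) * cr + R * c₁ * ((β + (β₁ + ct * β)) * (1 - (β + (β₁ + ct * β)) * (R * cr) * cr)⁻¹) * cr)) + θF) + (Fintype.card ι : ℝ) ^ 2 * ((ε₀ * (1 - (β + (β₁ + ct * β)) * (R * cr) * cr)⁻¹) + εF)) * cr)⁻¹ * cr) * Real.exp (-((ρ₃ / 4 - σ) * dZ y))) *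
        Real.exp (-((ρ₃ / 4 - 2 * σ) * g.dist y y'))) := by
  have hβb : 0 ≤ (β + (β₁ + ct * β)) := by positivity
  have hqi : 0 ≤ (1 - (β + (β₁ + ct * β)) * (R * cr) * cr)⁻¹ := inv_nonneg.2 (by linarith)
  have hB : 0 ≤ ((β + (β₁ + ct * β)) * (1 - (β + (β₁ + ct * β)) * (R * cr) * cr)⁻¹) := mul_nonneg hβb hqi
  have hθ : 0 ≤ (((Fintype.card J : ℝ) * (c₂ * ((β + (β₁ + ct * β)) * (1 - (β + (β₁ + ct * β)) * (R * cr) * cr)⁻¹) + 2 * (c₁ * ((β + (β₁ + ct * β)) * (1 - (β + (β₁ + ct * β)) * (R * cr) * cr)⁻¹))) + θW + cN * ((β + (β₁ + ct * β)) * (1 - (β + (β₁ + ct * β)) * (R * cr) * cr)⁻¹) * cr)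
          + ((ℓ * (Real.exp 1 * ε)⁻¹ + 2 * (ω + ℓ * d₁)) * R * ((β + (β₁ + ct * β)) * (1 - (β + (β₁ + ct * β)) * (R * cr) * cr)⁻¹) * cr + R * c₁ * ((β + (β₁ + ct * β)) * (1 - (β + (β₁ + ct * β)) * (R * cr) * cr)⁻¹) * cr)) := by positivity
  have hε' : 0 ≤ (ε₀ * (1 - (β + (β₁ + ct * β)) * (R * cr) * cr)⁻¹) := mul_nonneg hε₀ hqi
  -- files 31∕34: flat letters of each smooth-cut cube and its jet; file 23: the Neumann series is summable
  have hG := fun k => hasMaj_smoothCut_flat blk (S := Sk k) hβ hβ₁ hct (hχt k) (hsub k) (hcut k)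
  have hD := fun k => hasMaj_jet_smoothCut_flat blk τ n (S := Sk k) hβ hβ₁ hct (hχt k) (hdχt k) (hdχtb k) (hs k) (hsb k) (hdd k) (hddb k) (hcut k) (hcutF k) (hcutB k)
  have hunit := fun k => (hasMaj_dressedV_pair blk htri hd hrow hσ hβb hR hcr hσρ hρ₁V hρ₁G hρ₂ hρ₂₁ (hG k) (hD k) (hV k) hq).1
  have hunit₂ := fun k => (hasMaj_dressedV_pair blk htri hd hrow hσ hβb hR hcr hσρ hρ₁V hρ₁G hρ₂ hρ₂₁ (hG k) (hD k) (hV₂ k) hq).1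
  -- file 34: the cut letter of each dressed cube (two-sided; `M_χX = X`), weakened to the rate `ρ₃`
  have hGc : ∀ k, HasMaj (BlockNorm.ofBlocks g (liftBlk blk ι)) (BlockNorm.ofBlocks g (liftBlk blk ι)) (mulOp (fun p : X × ι => χX k p.1) ∘ₗ (projO none ∘ₗ bgPropV (stack (mulOp (fun p : X × ι => χtX k p.1) ∘ₗ N k)
          (fun j => Sum.elim (fun μ => fgrad n (liftEquiv (τ μ) ι)) (fun μ => bgrad n (liftEquiv (τ μ) ι)) j ∘ₗ (mulOp (fun p : X × ι => χtX k p.1) ∘ₗ N k))) (V k)))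
      (fun y y' => ind (Sk k) y * ind (Sk k) y' * (((β + (β₁ + ct * β)) * (1 - (β + (β₁ + ct * β)) * (R * cr) * cr)⁻¹) * Real.exp (-(ρ₃ * g.dist y y')))) := fun k => by
    rw [mulOp_comp_smoothCutDressed τ n (hχ k) (hNψ k) (hunit k)]
    exact (hasMaj_smoothCutDressed_loc₂ blk τ n htri hd hrow hσ hβ hβ₁ hct hR hcr hσρ hρ₁V hρ₁G hρ₂ hρ₂₁ (hSχ k) (hSψ k) (hχt k) (hdχt k) (hdχtb k) (hsub k) (hχ k) (hs k)
      (hsb k) (hdd k) (hddb k) (hNψ k) (hcut k) (hcutF k) (hcutB k) (hV k) hq).mono fun y y' =>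
        weight_mul_exp_rate_mono (mul_nonneg (ind_nonneg _ _) (ind_nonneg _ _)) hB hρ₃₂ (hd y y')
  have hGc₂ : ∀ k, HasMaj (BlockNorm.ofBlocks g (liftBlk blk ι)) (BlockNorm.ofBlocks g (liftBlk blk ι)) (mulOp (fun p : X × ι => χX k p.1) ∘ₗ (projO none ∘ₗ bgPropV (stack (mulOp (fun p : X × ι => χtX k p.1) ∘ₗ N k)
          (fun j => Sum.elim (fun μ => fgrad n (liftEquiv (τ μ) ι)) (fun μ => bgrad n (liftEquiv (τ μ) ι)) j ∘ₗ (mulOp (fun p : X × ι => χtX k p.1) ∘ₗ N k))) (V₂ k)))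
      (fun y y' => ind (Sk k) y * ind (Sk k) y' * (((β + (β₁ + ct * β)) * (1 - (β + (β₁ + ct * β)) * (R * cr) * cr)⁻¹) * Real.exp (-(ρ₃ * g.dist y y')))) := fun k => by
    rw [mulOp_comp_smoothCutDressed τ n (hχ k) (hNψ k) (hunit₂ k)]
    exact (hasMaj_smoothCutDressed_loc₂ blk τ n htri hd hrow hσ hβ hβ₁ hct hR hcr hσρ hρ₁V hρ₁G hρ₂ hρ₂₁ (hSχ k) (hSψ k) (hχt k) (hdχt k) (hdχtb k) (hsub k) (hχ k) (hs k)
      (hsb k) (hdd k) (hddb k) (hNψ k) (hcut k) (hcutF k) (hcutB k) (hV₂ k) hq).mono fun y y' =>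
        weight_mul_exp_rate_mono (mul_nonneg (ind_nonneg _ _) (ind_nonneg _ _)) hB hρ₃₂ (hd y y')
  -- file 38: the input-localized remainder row of each dressed cube (dag-n15-w4's row), at the rate `ρ₃`
  have hK : ∀ k, HasMaj (BlockNorm.ofBlocks g (liftBlk blk ι)) (BlockNorm.ofBlocks g (liftBlk blk ι)) (commOp (lapOp n (fun μ => liftEquiv (τ μ) ι) W + NL - (V k) ∘ₗ stack LinearMap.id (fun j => Sum.elim (fun μ => fgrad n (liftEquiv (τ μ) ι)) (fun μ => bgrad n (liftEquiv (τ μ) ι)) j)) (fun p : X × ι => hX k p.1) ∘ₗ (projO none ∘ₗ bgPropV (stack (mulOp (fun p : X × ι => χtX k p.1) ∘ₗ N k)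
          (fun j => Sum.elim (fun μ => fgrad n (liftEquiv (τ μ) ι)) (fun μ => bgrad n (liftEquiv (τ μ) ι)) j ∘ₗ (mulOp (fun p : X × ι => χtX k p.1) ∘ₗ N k))) (V k)))
      (fun y y' => ind (Sk k) y' * ((((Fintype.card J : ℝ) * (c₂ * ((β + (β₁ + ct * β)) * (1 - (β + (β₁ + ct * β)) * (R * cr) * cr)⁻¹) + 2 * (c₁ * ((β + (β₁ + ct * β)) * (1 - (β + (β₁ + ct * β)) * (R * cr) * cr)⁻¹))) + θW + cN * ((β + (β₁ + ct * β)) * (1 - (β + (β₁ + ct * β)) * (R * cr) * cr)⁻¹) * cr)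
          + ((ℓ * (Real.exp 1 * ε)⁻¹ + 2 * (ω + ℓ * d₁)) * R * ((β + (β₁ + ct * β)) * (1 - (β + (β₁ + ct * β)) * (R * cr) * cr)⁻¹) * cr + R * c₁ * ((β + (β₁ + ct * β)) * (1 - (β + (β₁ + ct * β)) * (R * cr) * cr)⁻¹) * cr)) * Real.exp (-(ρ₃ * g.dist y y')))) := fun k =>
    hasMaj_commOp_cubeOp_smoothCutDressed_in blk τ n htri hd hsymm hrow hσ hβ hβ₁ hct hR hcr hσρ hρ₁V hρ₁G hρ₂ hρ₂₁ hρ₃ hρ₃₂ hρ₃V hρ₃N hε hc₁ hc₂ hθW hcN hℓ hω hd₁ (hSχ k)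
      (hSψ k) (hχt k) (hdχt k) (hdχtb k) (hsub k) (hχ k) (hs k) (hsb k) (hdd k) (hddb k) (hs' k) (hsb' k) (hdd' k) (hddb' k) (hNψ k) (hcut k) (hcutF k) (hcutB k) (hV k) hq
      (hh1 k) (hh1b k) (hh2 k) (hLip k) (hrh k) hstep (hW k) (hKN k)
  have hK₂ : ∀ k, HasMaj (BlockNorm.ofBlocks g (liftBlk blk ι)) (BlockNorm.ofBlocks g (liftBlk blk ι)) (commOp (lapOp n (fun μ => liftEquiv (τ μ) ι) W + NL - (V₂ k) ∘ₗ stack LinearMap.id (fun j => Sum.elim (fun μ => fgrad n (liftEquiv (τ μ) ι)) (fun μ => bgrad n (liftEquiv (τ μ) ι)) j)) (fun p : X × ι => hX k p.1) ∘ₗ (projO none ∘ₗ bgPropV (stack (mulOp (fun p : X × ι => χtX k p.1) ∘ₗ N k)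
          (fun j => Sum.elim (fun μ => fgrad n (liftEquiv (τ μ) ι)) (fun μ => bgrad n (liftEquiv (τ μ) ι)) j ∘ₗ (mulOp (fun p : X × ι => χtX k p.1) ∘ₗ N k))) (V₂ k)))
      (fun y y' => ind (Sk k) y' * ((((Fintype.card J : ℝ) * (c₂ * ((β + (β₁ + ct * β)) * (1 - (β + (β₁ + ct * β)) * (R * cr) * cr)⁻¹) + 2 * (c₁ * ((β + (β₁ + ct * β)) * (1 - (β + (β₁ + ct * β)) * (R * cr) * cr)⁻¹))) + θW + cN * ((β + (β₁ + ct * β)) * (1 - (β + (β₁ + ct * β)) * (R * cr) * cr)⁻¹) * cr)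
          + ((ℓ * (Real.exp 1 * ε)⁻¹ + 2 * (ω + ℓ * d₁)) * R * ((β + (β₁ + ct * β)) * (1 - (β + (β₁ + ct * β)) * (R * cr) * cr)⁻¹) * cr + R * c₁ * ((β + (β₁ + ct * β)) * (1 - (β + (β₁ + ct * β)) * (R * cr) * cr)⁻¹) * cr)) * Real.exp (-(ρ₃ * g.dist y y')))) := fun k =>
    hasMaj_commOp_cubeOp_smoothCutDressed_in blk τ n htri hd hsymm hrow hσ hβ hβ₁ hct hR hcr hσρ hρ₁V hρ₁G hρ₂ hρ₂₁ hρ₃ hρ₃₂ hρ₃V hρ₃N hε hc₁ hc₂ hθW hcN hℓ hω hd₁ (hSχ k)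
      (hSψ k) (hχt k) (hdχt k) (hdχtb k) (hsub k) (hχ k) (hs k) (hsb k) (hdd k) (hddb k) (hs' k) (hsb' k) (hdd' k) (hddb' k) (hNψ k) (hcut k) (hcutF k) (hcutB k) (hV₂ k) hq
      (hh1 k) (hh1b k) (hh2 k) (hLip k) (hrh k) hstep (hW₂ k) (hKN k)
  -- file 33: the locality defect's letter of each dressed cube (output-localized), weakened to the rate `ρ₃`
  have hE : ∀ k, HasMaj (BlockNorm.ofBlocks g (liftBlk blk ι)) (BlockNorm.ofBlocks g (liftBlk blk ι)) ((fun k => ((-(mulOp (fun p : X × ι => hX k p.1) ∘ₗ NL ∘ₗ mulOp (1 - fun p : X × ι => χtX k p.1))) ∘ₗ N k) ∘ₗ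
          (LinearMap.id + ((V k) ∘ₗ stack LinearMap.id (fun j => Sum.elim (fun μ => fgrad n (liftEquiv (τ μ) ι)) (fun μ => bgrad n (liftEquiv (τ μ) ι)) j)) ∘ₗ (projO none ∘ₗ bgPropV (stack (mulOp (fun p : X × ι => χtX k p.1) ∘ₗ N k)
          (fun j => Sum.elim (fun μ => fgrad n (liftEquiv (τ μ) ι)) (fun μ => bgrad n (liftEquiv (τ μ) ι)) j ∘ₗ (mulOp (fun p : X × ι => χtX k p.1) ∘ₗ N k))) (V k)))) k)
      (fun y y' => ind (Sk k) y * ((ε₀ * (1 - (β + (β₁ + ct * β)) * (R * cr) * cr)⁻¹) * Real.exp (-(ρ₃ * g.dist y y')))) := fun k =>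
    (hasMaj_dressedTail_out blk htri hd hrow hσ hβb hR hε₀ hcr hσρ hρ₁V hρ₁G hρ₂ hρ₂₁ hρ₂T (fun _ => rfl) (hG k) (hD k) (hV k) hq (hT k)).mono fun y y' =>
      weight_mul_exp_rate_mono (ind_nonneg _ _) hε' hρ₃₂ (hd y y')
  have hE₂ : ∀ k, HasMaj (BlockNorm.ofBlocks g (liftBlk blk ι)) (BlockNorm.ofBlocks g (liftBlk blk ι)) ((fun k => ((-(mulOp (fun p : X × ι => hX k p.1) ∘ₗ NL ∘ₗ mulOp (1 - fun p : X × ι => χtX k p.1))) ∘ₗ N k) ∘ₗ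
          (LinearMap.id + ((V₂ k) ∘ₗ stack LinearMap.id (fun j => Sum.elim (fun μ => fgrad n (liftEquiv (τ μ) ι)) (fun μ => bgrad n (liftEquiv (τ μ) ι)) j)) ∘ₗ (projO none ∘ₗ bgPropV (stack (mulOp (fun p : X × ι => χtX k p.1) ∘ₗ N k)
          (fun j => Sum.elim (fun μ => fgrad n (liftEquiv (τ μ) ι)) (fun μ => bgrad n (liftEquiv (τ μ) ι)) j ∘ₗ (mulOp (fun p : X × ι => χtX k p.1) ∘ₗ N k))) (V₂ k)))) k)
      (fun y y' => ind (Sk k) y * ((ε₀ * (1 - (β + (β₁ + ct * β)) * (R * cr) * cr)⁻¹) * Real.exp (-(ρ₃ * g.dist y y')))) := fun k =>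
    (hasMaj_dressedTail_out blk htri hd hrow hσ hβb hR hε₀ hcr hσρ hρ₁V hρ₁G hρ₂ hρ₂₁ hρ₂T (fun _ => rfl) (hG k) (hD k) (hV₂ k) hq (hT k)).mono fun y y' =>
      weight_mul_exp_rate_mono (ind_nonneg _ _) hε' hρ₃₂ (hd y y')
  -- the far defect `F_k` of the local-gauge operator: its two rows join the remainder row and the defect row
  have hK' : ∀ k, HasMaj (BlockNorm.ofBlocks g (liftBlk blk ι)) (BlockNorm.ofBlocks g (liftBlk blk ι)) (commOp (mmulOp (ug k) ∘ₗ Δ ∘ₗ mmulOp (fun x => (ug k x)ᵀ)) (fun p : X × ι => hX k p.1) ∘ₗ (projO none ∘ₗ bgPropV (stack (mulOp (fun p : X × ι => χtX k p.1) ∘ₗ N k) (fun j => Sum.elim (fun μ => fgrad n (liftEquiv (τ μ) ι)) (fun μ => bgrad n (liftEquiv (τ μ) ι)) j ∘ₗ (mulOp (fun p : X × ι => χtX k p.1) ∘ₗ N k))) (V k)))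
      (fun y y' => ind (Sk k) y' * (((((Fintype.card J : ℝ) * (c₂ * ((β + (β₁ + ct * β)) * (1 - (β + (β₁ + ct * β)) * (R * cr) * cr)⁻¹) + 2 * (c₁ * ((β + (β₁ + ct * β)) * (1 - (β + (β₁ + ct * β)) * (R * cr) * cr)⁻¹))) + θW + cN * ((β + (β₁ + ct * β)) * (1 - (β + (β₁ + ct * β)) * (R * cr) * cr)⁻¹) * cr)
          + ((ℓ * (Real.exp 1 * ε)⁻¹ + 2 * (ω + ℓ * d₁)) * R * ((β + (β₁ + ct * β)) * (1 - (β + (β₁ + ct * β)) * (R * cr) * cr)⁻¹) * cr + R * c₁ * ((β + (β₁ + ct * β)) * (1 - (β + (β₁ + ct * β)) * (R * cr) * cr)⁻¹) * cr)) + θF) * Real.exp (-(ρ₃ * g.dist y y')))) := fun k => by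
    rw [hcov k, show ∀ (A B : (X × ι → ℝ) →ₗ[ℝ] (X × ι → ℝ)) (a : X × ι → ℝ) (G : (X × ι → ℝ) →ₗ[ℝ] (X × ι → ℝ)), commOp (A + B) a ∘ₗ G = commOp A a ∘ₗ G + commOp B a ∘ₗ G from
      fun A B a G => by simp only [commOp, LinearMap.add_comp, LinearMap.comp_add, LinearMap.sub_comp]; abel]
    exact ((hK k).add (hFK k)).mono fun y y' => le_of_eq (by ring)
  have hK'₂ : ∀ k, HasMaj (BlockNorm.ofBlocks g (liftBlk blk ι)) (BlockNorm.ofBlocks g (liftBlk blk ι)) (commOp (mmulOp (ug₂ k) ∘ₗ Δ₂ ∘ₗ mmulOp (fun x => (ug₂ k x)ᵀ)) (fun p : X × ι => hX k p.1) ∘ₗ (projO none ∘ₗ bgPropV (stack (mulOp (fun p : X × ι => χtX k p.1) ∘ₗ N k) (fun j => Sum.elim (fun μ => fgrad n (liftEquiv (τ μ) ι)) (fun μ => bgrad n (liftEquiv (τ μ) ι)) j ∘ₗ (mulOp (fun p : X × ι => χtX k p.1) ∘ₗ N k))) (V₂ k)))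
      (fun y y' => ind (Sk k) y' * (((((Fintype.card J : ℝ) * (c₂ * ((β + (β₁ + ct * β)) * (1 - (β + (β₁ + ct * β)) * (R * cr) * cr)⁻¹) + 2 * (c₁ * ((β + (β₁ + ct * β)) * (1 - (β + (β₁ + ct * β)) * (R * cr) * cr)⁻¹))) + θW + cN * ((β + (β₁ + ct * β)) * (1 - (β + (β₁ + ct * β)) * (R * cr) * cr)⁻¹) * cr)
          + ((ℓ * (Real.exp 1 * ε)⁻¹ + 2 * (ω + ℓ * d₁)) * R * ((β + (β₁ + ct * β)) * (1 - (β + (β₁ + ct * β)) * (R * cr) * cr)⁻¹) * cr + R * c₁ * ((β + (β₁ + ct * β)) * (1 - (β + (β₁ + ct * β)) * (R * cr) * cr)⁻¹) * cr)) + θF) * Real.exp (-(ρ₃ * g.dist y y')))) := fun k => by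
    rw [hcov₂ k, show ∀ (A B : (X × ι → ℝ) →ₗ[ℝ] (X × ι → ℝ)) (a : X × ι → ℝ) (G : (X × ι → ℝ) →ₗ[ℝ] (X × ι → ℝ)), commOp (A + B) a ∘ₗ G = commOp A a ∘ₗ G + commOp B a ∘ₗ G from
      fun A B a G => by simp only [commOp, LinearMap.add_comp, LinearMap.comp_add, LinearMap.sub_comp]; abel]
    exact ((hK₂ k).add (hFK₂ k)).mono fun y y' => le_of_eq (by ring)
  have hE' : ∀ k, HasMaj (BlockNorm.ofBlocks g (liftBlk blk ι)) (BlockNorm.ofBlocks g (liftBlk blk ι)) (((-(mulOp (fun p : X × ι => hX k p.1) ∘ₗ NL ∘ₗ mulOp (1 - fun p : X × ι => χtX k p.1))) ∘ₗ N k) ∘ₗ (LinearMap.id + (V k ∘ₗ stack LinearMap.id (fun j => Sum.elim (fun μ => fgrad n (liftEquiv (τ μ) ι)) (fun μ => bgrad n (liftEquiv (τ μ) ι)) j)) ∘ₗ (projO none ∘ₗ bgPropV (stack (mulOp (fun p : X × ι => χtX k p.1) ∘ₗ N k) (fun j => Sum.elim (fun μ => fgrad n (liftEquiv (τ μ) ι))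 (fun μ => bgrad n (liftEquiv (τ μ) ι)) j ∘ₗ (mulOp (fun p : X × ι => χtX k p.1) ∘ₗ N k))) (V k))) + mulOp (fun p : X × ι => hX k p.1) ∘ₗ F k ∘ₗ (projO none ∘ₗ bgPropV (stack (mulOp (fun p : X × ι => χtX k p.1) ∘ₗ N k) (fun j => Sum.elim (fun μ => fgrad n (liftEquiv (τ μ) ι)) (fun μ => bgrad n (liftEquiv (τ μ) ι)) j ∘ₗ (mulOp (fun p : X × ι => χtX k p.1) ∘ₗ N k))) (V k)))
      (fun y y' => ind (Sk k) y * (((ε₀ * (1 - (β + (β₁ + ct * β)) * (R * cr) * cr)⁻¹) + εF) * Real.exp (-(ρ₃ * g.dist y y')))) := fun k =>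
    ((hE k).add (hFX k)).mono fun y y' => le_of_eq (by ring)
  have hE'₂ : ∀ k, HasMaj (BlockNorm.ofBlocks g (liftBlk blk ι)) (BlockNorm.ofBlocks g (liftBlk blk ι)) (((-(mulOp (fun p : X × ι => hX k p.1) ∘ₗ NL ∘ₗ mulOp (1 - fun p : X × ι => χtX k p.1))) ∘ₗ N k) ∘ₗ (LinearMap.id + (V₂ k ∘ₗ stack LinearMap.id (fun j => Sum.elim (fun μ => fgrad n (liftEquiv (τ μ) ι)) (fun μ => bgrad n (liftEquiv (τ μ) ι)) j)) ∘ₗ (projO none ∘ₗ bgPropV (stack (mulOp (fun p : X × ι => χtX k p.1) ∘ₗ N k) (fun j => Sum.elim (fun μ => fgrad n (liftEquiv (τ μ) ι)) (fun μ => bgrad n (liftEquiv (τ μ) ι)) j ∘ₗ (mulOp (fun p : X × ι => χtX k p.1) ∘ₗ N k))) (V₂ k))) + mulOp (fun p : X × ι => hX k p.1) ∘ₗ F₂ k ∘ₗ (projO none ∘ₗ bgPropV (stack (mulOp (fun p : X × ι => χtX k p.1) ∘ₗ N k) (fun j => Sum.elim (fun μ => fgrad n (liftEquiv (τ μ) ι))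 (fun μ => bgrad n (liftEquiv (τ μ) ι)) j ∘ₗ (mulOp (fun p : X × ι => χtX k p.1) ∘ₗ N k))) (V₂ k)))
      (fun y y' => ind (Sk k) y * (((ε₀ * (1 - (β + (β₁ + ct * β)) * (R * cr) * cr)⁻¹) + εF) * Real.exp (-(ρ₃ * g.dist y y')))) := fun k =>
    ((hE₂ k).add (hFX₂ k)).mono fun y y' => le_of_eq (by ring)
  -- n15-c∕293 §1: on the cubes not `Far` the two dressed cubes are `2β̄(R_cβ̄′c_r)c_r`-close (both are `(Ĝ_kV̂)X̂`-corrections of the same flat cube), weakened to the rate `ρ₃`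
  have hGG : ∀ k, ¬Far k → HasMaj (BlockNorm.ofBlocks g (liftBlk blk ι)) (BlockNorm.ofBlocks g (liftBlk blk ι)) (mulOp (fun p : X × ι => χX k p.1) ∘ₗ ((projO none ∘ₗ bgPropV (stack (mulOp (fun p : X × ι => χtX k p.1) ∘ₗ N k) (fun j => Sum.elim (fun μ => fgrad n (liftEquiv (τ μ) ι)) (fun μ => bgrad n (liftEquiv (τ μ) ι)) j ∘ₗ (mulOp (fun p : X × ι => χtX k p.1) ∘ₗ N k))) (V k)) - (projO none ∘ₗ bgPropV (stack (mulOp (fun p : X × ι => χtX k p.1) ∘ₗ N k) (fun j => Sum.elim (fun μ => fgrad n (liftEquiv (τ μ) ι)) (fun μ => bgrad n (liftEquiv (τ μ) ι)) j ∘ₗ (mulOp (fun p : X × ι => χtX k p.1) ∘ₗ N k))) (V₂ k))))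
      (fun y y' => ind (Sk k) y * ind (Sk k) y' * ((2 * ((β + (β₁ + ct * β)) * (Rc * ((β + (β₁ + ct * β)) * (1 - (β + (β₁ + ct * β)) * (R * cr) * cr)⁻¹) * cr) * cr)) * Real.exp (-(ρ₃ * g.dist y y')))) := fun k hk =>
    (hasMaj_smoothCutDressed_sub_loc₂ blk τ n htri hd hrow hσ hβ hβ₁ hct hRc hRcR hcr hσρ hρ₁V hρ₁G hρ₂ hρ₂₁ (hSχ k) (hSψ k) (hχt k) (hdχt k) (hdχtb k) (hsub k) (hχ k) (hs k) (hsb k)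
      (hdd k) (hddb k) (hNψ k) (hcut k) (hcutF k) (hcutB k) (hVc k hk) (hVc₂ k hk) hq).mono fun y y' =>
        weight_mul_exp_rate_mono (mul_nonneg (ind_nonneg _ _) (ind_nonneg _ _)) (mul_nonneg zero_le_two (mul_nonneg (mul_nonneg hβb (mul_nonneg (mul_nonneg hRc hB) hcr)) hcr)) hρ₃₂ (hd y y')
  -- file 34: the one-grid JET rows of the dressed cubes (`∇^±_μX_k`, `M_χX = X`) at the rate `ρ₃`
  have hDGj : ∀ k, HasMaj (BlockNorm.ofBlocks g (liftBlk blk ι)) (BlockNorm.ofBlocks g (liftBlk blk ι)) (Sum.elim (fun μ => fgrad n (liftEquiv (τ μ) ι)) (fun μ => bgrad n (liftEquiv (τ μ) ι)) jj ∘ₗ (mulOp (fun p : X × ι => χX k p.1) ∘ₗ (projO none ∘ₗ bgPropV (stack (mulOp (fun p : X × ι => χtX k p.1) ∘ₗ N k) (fun j => Sum.elim (fun μ => fgrad n (liftEquiv (τ μ) ι)) (fun μ => bgrad n (liftEquiv (τ μ) ι)) j ∘ₗ (mulOp (fun p : X × ι => χtX k p.1) ∘ₗ N k))) (V k))))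
      (fun y y' => ind (Sk k) y * ind (Sk k) y' * (((β + (β₁ + ct * β)) * (1 - (β + (β₁ + ct * β)) * (R * cr) * cr)⁻¹) * Real.exp (-(ρ₃ * g.dist y y')))) := fun k => by
    rw [mulOp_comp_smoothCutDressed τ n (hχ k) (hNψ k) (hunit k)]
    cases jj with
    | inl μ => exact (hasMaj_fgrad_smoothCutDressed_loc₂ blk τ n htri hd hrow hσ hβ hβ₁ hct hR hcr hσρ hρ₁V hρ₁G hρ₂ hρ₂₁ (hSχ k) (hSψ k) (hχt k) (hdχt k) (hdχtb k) (hsub k) (hs k) (hsb k) (hdd k) (hddb k) (hs' k) (hsb' k) (hdd' k) (hddb' k) (hNψ k) (hcut k) (hcutF k) (hcutB k) (hV k) hq μ).mono fun y y' => weight_mul_exp_rate_mono (mul_nonneg (ind_nonneg _ _) (ind_nonneg _ _)) hB hρ₃₂ (hd y y')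
    | inr μ => exact (hasMaj_bgrad_smoothCutDressed_loc₂ blk τ n htri hd hrow hσ hβ hβ₁ hct hR hcr hσρ hρ₁V hρ₁G hρ₂ hρ₂₁ (hSχ k) (hSψ k) (hχt k) (hdχt k) (hdχtb k) (hsub k) (hs k) (hsb k) (hdd k) (hddb k) (hs' k) (hsb' k) (hdd' k) (hddb' k) (hNψ k) (hcut k) (hcutF k) (hcutB k) (hV k) hq μ).mono fun y y' => weight_mul_exp_rate_mono (mul_nonneg (ind_nonneg _ _) (ind_nonneg _ _)) hB hρ₃₂ (hd y y')
  have hDGj₂ : ∀ k, HasMaj (BlockNorm.ofBlocks g (liftBlk blk ι)) (BlockNorm.ofBlocks g (liftBlk blk ι)) (Sum.elim (fun μ => fgrad n (liftEquiv (τ μ) ι)) (fun μ => bgrad n (liftEquiv (τ μ) ι)) jj ∘ₗ (mulOp (fun p : X × ι => χX k p.1) ∘ₗ (projO none ∘ₗ bgPropV (stack (mulOp (fun p : X × ι => χtX k p.1) ∘ₗ N k) (fun j => Sum.elim (fun μ => fgrad n (liftEquiv (τ μ) ι)) (fun μ => bgrad n (liftEquiv (τ μ) ι)) j ∘ₗ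 (mulOp (fun p : X × ι => χtX k p.1) ∘ₗ N k))) (V₂ k))))
      (fun y y' => ind (Sk k) y * ind (Sk k) y' * (((β + (β₁ + ct * β)) * (1 - (β + (β₁ + ct * β)) * (R * cr) * cr)⁻¹) * Real.exp (-(ρ₃ * g.dist y y')))) := fun k => by
    rw [mulOp_comp_smoothCutDressed τ n (hχ k) (hNψ k) (hunit₂ k)]
    cases jj with
    | inl μ => exact (hasMaj_fgrad_smoothCutDressed_loc₂ blk τ n htri hd hrow hσ hβ hβ₁ hct hR hcr hσρ hρ₁V hρ₁G hρ₂ hρ₂₁ (hSχ k) (hSψ k) (hχt k) (hdχt k) (hdχtb k) (hsub k) (hs k) (hsb k) (hdd k) (hddb k) (hs' k) (hsb' k) (hdd' k) (hddb' k) (hNψ k) (hcut k) (hcutF k) (hcutB k) (hV₂ k) hq μ).mono fun y y' => weight_mul_exp_rate_mono (mul_nonneg (ind_nonneg _ _) (ind_nonneg _ _)) hB hρ₃₂ (hd y y')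
    | inr μ => exact (hasMaj_bgrad_smoothCutDressed_loc₂ blk τ n htri hd hrow hσ hβ hβ₁ hct hR hcr hσρ hρ₁V hρ₁G hρ₂ hρ₂₁ (hSχ k) (hSψ k) (hχt k) (hdχt k) (hdχtb k) (hsub k) (hs k) (hsb k) (hdd k) (hddb k) (hs' k) (hsb' k) (hdd' k) (hddb' k) (hNψ k) (hcut k) (hcutF k) (hcutB k) (hV₂ k) hq μ).mono fun y y' => weight_mul_exp_rate_mono (mul_nonneg (ind_nonneg _ _) (ind_nonneg _ _)) hB hρ₃₂ (hd y y')
  -- the species part `P_k` after the cut dressed cube: output-localized ∘ two-sided localized (row sum `(σ, c_r)`, `ρ₃ + σ ≤ ρ_P`)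
  have hPX : ∀ k, HasMaj (BlockNorm.ofBlocks g (liftBlk blk ι)) (BlockNorm.ofBlocks g (liftBlk blk ι)) (P k ∘ₗ (mulOp (fun p : X × ι => χX k p.1) ∘ₗ (projO none ∘ₗ bgPropV (stack (mulOp (fun p : X × ι => χtX k p.1) ∘ₗ N k) (fun j => Sum.elim (fun μ => fgrad n (liftEquiv (τ μ) ι)) (fun μ => bgrad n (liftEquiv (τ μ) ι)) j ∘ₗ (mulOp (fun p : X × ι => χtX k p.1) ∘ₗ N k))) (V k))))
      (fun y y' => ind (Sk k) y * ind (Sk k) y' * (rP * ((β + (β₁ + ct * β)) * (1 - (β + (β₁ + ct * β)) * (R * cr) * cr)⁻¹) * cr * Real.exp (-(ρ₃ * g.dist y y')))) := fun k =>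
    hasMaj_comp_exp_out_loc₂ (liftBlk blk ι) htri hd hrow hrP hB hρ₃ le_rfl hρP (hP k) (hGc k)
  have hPX₂ : ∀ k, HasMaj (BlockNorm.ofBlocks g (liftBlk blk ι)) (BlockNorm.ofBlocks g (liftBlk blk ι)) (P₂ k ∘ₗ (mulOp (fun p : X × ι => χX k p.1) ∘ₗ (projO none ∘ₗ bgPropV (stack (mulOp (fun p : X × ι => χtX k p.1) ∘ₗ N k) (fun j => Sum.elim (fun μ => fgrad n (liftEquiv (τ μ) ι)) (fun μ => bgrad n (liftEquiv (τ μ) ι)) j ∘ₗ (mulOp (fun p : X × ι => χtX k p.1) ∘ₗ N k))) (V₂ k))))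
      (fun y y' => ind (Sk k) y * ind (Sk k) y' * (rP * ((β + (β₁ + ct * β)) * (1 - (β + (β₁ + ct * β)) * (R * cr) * cr)⁻¹) * cr * Real.exp (-(ρ₃ * g.dist y y')))) := fun k =>
    hasMaj_comp_exp_out_loc₂ (liftBlk blk ι) htri hd hrow hrP hB hρ₃ le_rfl hρP (hP₂ k) (hGc₂ k)
  -- the far part is annihilated by the cut-off; the three pieces of `D` read in the cube's gauge, after the cut dressed cube
  have hDl : ∀ k, HasMaj (BlockNorm.ofBlocks g (liftBlk blk ι)) (BlockNorm.ofBlocks g (liftBlk blk ι)) ((Sum.elim (fun μ => fgrad n (liftEquiv (τ μ) ι)) (fun μ => bgrad n (liftEquiv (τ μ) ι)) jj + P k + Pf k) ∘ₗ (mulOp (fun p : X × ι => χX k p.1) ∘ₗ (projO none ∘ₗ bgPropV (stack (mulOp (fun p : X × ι => χtX k p.1) ∘ₗ N k) (fun j => Sum.elim (fun μ => fgrad n (liftEquiv (τ μ) ι)) (fun μ => bgrad n (liftEquiv (τ μ) ι)) j ∘ₗ (mulOp (fun p : X × ι => χtX k p.1) ∘ₗ N k))) (V k))))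
      (fun y y' => ind (Sk k) y * ind (Sk k) y' * ((((β + (β₁ + ct * β)) * (1 - (β + (β₁ + ct * β)) * (R * cr) * cr)⁻¹) + rP * ((β + (β₁ + ct * β)) * (1 - (β + (β₁ + ct * β)) * (R * cr) * cr)⁻¹) * cr) * Real.exp (-(ρ₃ * g.dist y y')))) := fun k => by
    rw [LinearMap.add_comp, LinearMap.add_comp, ← LinearMap.comp_assoc _ (mulOp (fun p : X × ι => χX k p.1)) (Pf k), hPf k, LinearMap.zero_comp, add_zero]
    exact ((hDGj k).add (hPX k)).mono fun y y' => le_of_eq (by ring)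
  have hDl₂ : ∀ k, HasMaj (BlockNorm.ofBlocks g (liftBlk blk ι)) (BlockNorm.ofBlocks g (liftBlk blk ι)) ((Sum.elim (fun μ => fgrad n (liftEquiv (τ μ) ι)) (fun μ => bgrad n (liftEquiv (τ μ) ι)) jj + P₂ k + Pf₂ k) ∘ₗ (mulOp (fun p : X × ι => χX k p.1) ∘ₗ (projO none ∘ₗ bgPropV (stack (mulOp (fun p : X × ι => χtX k p.1) ∘ₗ N k) (fun j => Sum.elim (fun μ => fgrad n (liftEquiv (τ μ) ι)) (fun μ => bgrad n (liftEquiv (τ μ) ι)) j ∘ₗ (mulOp (fun p : X × ι => χtX k p.1) ∘ₗ N k))) (V₂ k))))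
      (fun y y' => ind (Sk k) y * ind (Sk k) y' * ((((β + (β₁ + ct * β)) * (1 - (β + (β₁ + ct * β)) * (R * cr) * cr)⁻¹) + rP * ((β + (β₁ + ct * β)) * (1 - (β + (β₁ + ct * β)) * (R * cr) * cr)⁻¹) * cr) * Real.exp (-(ρ₃ * g.dist y y')))) := fun k => by
    rw [LinearMap.add_comp, LinearMap.add_comp, ← LinearMap.comp_assoc _ (mulOp (fun p : X × ι => χX k p.1)) (Pf₂ k), hPf₂ k, LinearMap.zero_comp, add_zero]
    exact ((hDGj₂ k).add (hPX₂ k)).mono fun y y' => le_of_eq (by ring)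
  have hB1 : 0 ≤ (((β + (β₁ + ct * β)) * (1 - (β + (β₁ + ct * β)) * (R * cr) * cr)⁻¹) + rP * ((β + (β₁ + ct * β)) * (1 - (β + (β₁ + ct * β)) * (R * cr) * cr)⁻¹) * cr) := by positivity
  -- §1: on the cubes not `Far` the JET rows of the two dressed cubes are close (both jets are `(∇Ĝ_kV̂)X̂`-corrections of the same flat jet), and the species parts of the two
  -- left factors are small after the cut dressed cubes: the `D♯`-cut rows are `ε_D`-close, `ε_D = 2β̄(R_cβ̄′c_r)c_r + 2r_Pβ̄′c_r`
  have hEG : 0 ≤ (2 * ((β + (β₁ + ct * β)) * (Rc * ((β + (β₁ + ct * β)) * (1 - (β + (β₁ + ct * β)) * (R * cr) * cr)⁻¹) * cr) * cr)) := mul_nonneg zero_le_two (mul_nonneg (mul_nonneg hβb (mul_nonneg (mul_nonneg hRc hB) hcr)) hcr)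
  have hDGG : ∀ k, ¬Far k → HasMaj (BlockNorm.ofBlocks g (liftBlk blk ι)) (BlockNorm.ofBlocks g (liftBlk blk ι))
      ((Sum.elim (fun μ => fgrad n (liftEquiv (τ μ) ι)) (fun μ => bgrad n (liftEquiv (τ μ) ι)) jj + P k + Pf k) ∘ₗ (mulOp (fun p : X × ι => χX k p.1) ∘ₗ (projO none ∘ₗ bgPropV (stack (mulOp (fun p : X × ι => χtX k p.1) ∘ₗ N k) (fun j => Sum.elim (fun μ => fgrad n (liftEquiv (τ μ) ι)) (fun μ => bgrad n (liftEquiv (τ μ) ι)) j ∘ₗ (mulOp (fun p : X × ι => χtX k p.1) ∘ₗ N k))) (V k))) - (Sum.elim (fun μ => fgrad n (liftEquiv (τ μ) ι)) (fun μ => bgrad n (liftEquiv (τ μ) ι)) jj + P₂ k + Pf₂ k) ∘ₗ (mulOp (fun p : X × ι => χX k p.1) ∘ₗ (projO none ∘ₗ bgPropV (stack (mulOp (fun p : X × ι => χtX k p.1) ∘ₗ N k) (fun j => Sum.elim (fun μ => fgrad n (liftEquiv (τ μ) ι)) (fun μ => bgrad n (liftEquiv (τ μ) ι)) j ∘ₗ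 (mulOp (fun p : X × ι => χtX k p.1) ∘ₗ N k))) (V₂ k))))
      (fun y y' => ind (Sk k) y * ind (Sk k) y' * (((2 * ((β + (β₁ + ct * β)) * (Rc * ((β + (β₁ + ct * β)) * (1 - (β + (β₁ + ct * β)) * (R * cr) * cr)⁻¹) * cr) * cr)) + 2 * (rP * ((β + (β₁ + ct * β)) * (1 - (β + (β₁ + ct * β)) * (R * cr) * cr)⁻¹) * cr)) * Real.exp (-(ρ₃ * g.dist y y')))) := fun k hk => by
    rw [LinearMap.add_comp, LinearMap.add_comp, ← LinearMap.comp_assoc _ (mulOp (fun p : X × ι => χX k p.1)) (Pf k), hPf k, LinearMap.zero_comp, add_zero,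
      LinearMap.add_comp, LinearMap.add_comp, ← LinearMap.comp_assoc _ (mulOp (fun p : X × ι => χX k p.1)) (Pf₂ k), hPf₂ k, LinearMap.zero_comp, add_zero,
      show ∀ (A₁ A₂ A₃ A₄ : (X × ι → ℝ) →ₗ[ℝ] (X × ι → ℝ)), (A₁ + A₂) - (A₃ + A₄) = (A₁ - A₃) + (A₂ - A₄) from fun _ _ _ _ => by abel]
    have hJ := (hasMaj_jet_smoothCutDressed_sub_loc₂ blk τ n htri hd hrow hσ hβ hβ₁ hct hRc hRcR hcr hσρ hρ₁V hρ₁G hρ₂ hρ₂₁ (hSχ k) (hSψ k) (hχt k) (hdχt k) (hdχtb k) (hsub k) (hχ k)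
      (hs k) (hsb k) (hdd k) (hddb k) (hs' k) (hsb' k) (hdd' k) (hddb' k) (hNψ k) (hcut k) (hcutF k) (hcutB k) (hVc k hk) (hVc₂ k hk) hq jj).mono fun y y' =>
        weight_mul_exp_rate_mono (mul_nonneg (ind_nonneg _ _) (ind_nonneg _ _)) hEG hρ₃₂ (hd y y')
    exact (hJ.add ((hPX k).sub (hPX₂ k))).mono fun y y' => le_of_eq (by ring)
  -- n15-c∕300: walk locality of a left factor through FILE 46's glued operator with close near data (remainder and defect rows are small in BOTH families: closeness `2θ₀`, `2ε`)
  have hfin := hasMaj_comp_glued_sub_of_localGauges_close blk Sk ug vg Δ Dg (fun k => Sum.elim (fun μ => fgrad n (liftEquiv (τ μ) ι)) (fun μ => bgrad n (liftEquiv (τ μ) ι)) jj + P k + Pf k) hX χX hsX dhX (fun k => projO none ∘ₗ bgPropV (stack (mulOp (fun p : X × ι => χtX k p.1) ∘ₗ N k) (fun j => Sum.elim (fun μ => fgrad n (liftEquiv (τ μ) ι)) (fun μ => bgrad n (liftEquiv (τ μ) ι)) j ∘ₗ (mulOp (fun p : X × ι => χtX k p.1) ∘ₗ N k))) (V k)) (fun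 k => (((-(mulOp (fun p : X × ι => hX k p.1) ∘ₗ NL ∘ₗ mulOp (1 - fun p : X × ι => χtX k p.1))) ∘ₗ N k) ∘ₗ (LinearMap.id + (V k ∘ₗ stack LinearMap.id (fun j => Sum.elim (fun μ => fgrad n (liftEquiv (τ μ) ι)) (fun μ => bgrad n (liftEquiv (τ μ) ι)) j)) ∘ₗ (projO none ∘ₗ bgPropV (stack (mulOp (fun p : X × ι => χtX k p.1) ∘ₗ N k) (fun j => Sum.elim (fun μ => fgrad n (liftEquiv (τ μ) ι)) (fun μ => bgrad n (liftEquiv (τ μ) ι)) j ∘ₗ (mulOp (fun p : X × ι => χtX k p.1) ∘ₗ N k))) (V k))) + mulOp (fun p : X × ι => hX k p.1) ∘ₗ F k ∘ₗ (projO none ∘ₗ bgPropV (stack (mulOp (fun p : X × ι => χtX k p.1) ∘ₗ N k) (fun j => Sum.elim (fun μ => fgrad n (liftEquiv (τ μ) ι)) (fun μ => bgrad n (liftEquiv (τ μ) ι)) j ∘ₗ (mulOp (fun p : X × ι => χtX k p.1) ∘ₗ N k))) (V k))))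
    ug₂ vg₂ Δ₂ Dg₂ (fun k => Sum.elim (fun μ => fgrad n (liftEquiv (τ μ) ι)) (fun μ => bgrad n (liftEquiv (τ μ) ι)) jj + P₂ k + Pf₂ k) (fun k => projO none ∘ₗ bgPropV (stack (mulOp (fun p : X × ι => χtX k p.1) ∘ₗ N k) (fun j => Sum.elim (fun μ => fgrad n (liftEquiv (τ μ) ι)) (fun μ => bgrad n (liftEquiv (τ μ) ι)) j ∘ₗ (mulOp (fun p : X × ι => χtX k p.1) ∘ₗ N k))) (V₂ k)) (fun k => (((-(mulOp (fun p : X × ι => hX k p.1) ∘ₗ NL ∘ₗ mulOp (1 - fun p : X × ι => χtX k p.1))) ∘ₗ N k) ∘ₗ (LinearMap.id + (V₂ k ∘ₗ stack LinearMap.id (fun j => Sum.elim (fun μ => fgrad n (liftEquiv (τ μ) ι)) (fun μ => bgrad n (liftEquiv (τ μ) ι)) j)) ∘ₗ (projO none ∘ₗ bgPropV (stack (mulOp (fun p : X × ι => χtX k p.1) ∘ₗ N k) (fun j => Sum.elim (fun μ => fgrad n (liftEquiv (τ μ) ι)) (fun μ => bgrad n (liftEquiv (τ μ) ι)) j ∘ₗ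 (mulOp (fun p : X × ι => χtX k p.1) ∘ₗ N k))) (V₂ k))) + mulOp (fun p : X × ι => hX k p.1) ∘ₗ F₂ k ∘ₗ (projO none ∘ₗ bgPropV (stack (mulOp (fun p : X × ι => χtX k p.1) ∘ₗ N k) (fun j => Sum.elim (fun μ => fgrad n (liftEquiv (τ μ) ι)) (fun μ => bgrad n (liftEquiv (τ μ) ι)) j ∘ₗ (mulOp (fun p : X × ι => χtX k p.1) ∘ₗ N k))) (V₂ k)))) Far Z dZ htri hd hd0 hrow hσ hcr hdZ hdZ0 hug hug' hvg' hug₂ hug₂' hvg₂'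
    (β := (β + (β₁ + ct * β)) * (1 - (β + (β₁ + ct * β)) * (R * cr) * cr)⁻¹) (β₁ := ((β + (β₁ + ct * β)) * (1 - (β + (β₁ + ct * β)) * (R * cr) * cr)⁻¹) + rP * ((β + (β₁ + ct * β)) * (1 - (β + (β₁ + ct * β)) * (R * cr) * cr)⁻¹) * cr) (εG := 2 * ((β + (β₁ + ct * β)) * (Rc * ((β + (β₁ + ct * β)) * (1 - (β + (β₁ + ct * β)) * (R * cr) * cr)⁻¹) * cr) * cr)) (εD := (2 * ((β + (β₁ + ct * β)) * (Rc * ((β + (β₁ + ct * β)) * (1 - (β + (β₁ + ct * β)) * (R * cr) * cr)⁻¹) * cr) * cr)) + 2 * (rP * ((β + (β₁ + ct * β)) * (1 - (β + (β₁ + ct * β)) * (R * cr) * cr)⁻¹) * cr))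
    (εK := 2 * ((((Fintype.card J : ℝ) * (c₂ * ((β + (β₁ + ct * β)) * (1 - (β + (β₁ + ct * β)) * (R * cr) * cr)⁻¹) + 2 * (c₁ * ((β + (β₁ + ct * β)) * (1 - (β + (β₁ + ct * β)) * (R * cr) * cr)⁻¹))) + θW + cN * ((β + (β₁ + ct * β)) * (1 - (β + (β₁ + ct * β)) * (R * cr) * cr)⁻¹) * cr) + ((ℓ * (Real.exp 1 * ε)⁻¹ + 2 * (ω + ℓ * d₁)) * R * ((β + (β₁ + ct * β)) * (1 - (β + (β₁ + ct * β)) * (R * cr) * cr)⁻¹) * cr + R * c₁ * ((β + (β₁ + ct * β)) * (1 - (β + (β₁ + ct * β)) * (R * cr) * cr)⁻¹) * cr)) + θF)) (εE := 2 * ((ε₀ * (1 - (β + (β₁ + ct * β)) * (R * cr) * cr)⁻¹) + εF)) hB hB1 hcs hcd (add_nonneg hθ hθF) (add_nonneg hε' hεF) hEG (add_nonneg hEG (mul_nonneg zero_le_two (mul_nonneg (mul_nonneg hrP hB) hcr)))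
    (mul_nonneg zero_le_two (add_nonneg hθ hθF)) (mul_nonneg zero_le_two (add_nonneg hε' hεF)) hNov hσρ₃ hDcov hDcov₂ hDleib hDleib₂ hhcut (fun k p => hhabs k p.1) hhs hdh hN hZ hWW hvv
    hGc hGc₂ hDl hDl₂ hK' hK'₂ hE' hE'₂ hGG hDGG (fun k hk => by have h₂ := hK'₂ k; rw [hWW k hk] at h₂; exact ((hK' k).sub h₂).mono fun y y' => le_of_eq (by ring)) (fun k _ => ((hE' k).sub (hE'₂ k)).mono fun y y' => le_of_eq (by ring)) hq'
  exact hfin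

end Glue

end Summit.QuantumFields.YangMills.BalabanUVNodes.N15.CurvedSpecies

end
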